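import Literature.Probability.Percolation.MarkedLoopLawTwoCellCap
import Literature.Probability.Percolation.MarkedLoopLawContractOfDarts
import HarnessLib

/-!
# The two-cell cap identity for constructed domains: two adjacent hexagons attached by darts («TWO-CELL-OF-DARTS»)

Topic `Literature/Probability/Percolation`; the constructor companion of `MarkedLoopLawTwoCellCap.lean` («LAW-TWO-CELL-CAP»: ★★★★ `TwoCellData.lawLP_eq_twoCellCap` for a
`TwoCellData W D …` and three `TwoCellMarks`), exactly as `MarkedLoopLawContractOfDarts.lean` («CONTRACT-OF-DARTS», #945) is the constructor companion of F2 and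
`MarkedLoopLawSlideOfDarts.lean` («SLIDE-OF-DARTS», #879) of the SLIDE: from a COORDINATE DATUM `TwoCellDarts D₀ D₁ D₂ h₁ h₂ r₁ m₁ r₂ m₂ bz S₀` (three unmarked discrete domains
`G ⊂ G ∪ {h₁} ⊂ G ∪ {h₁, h₂}`, `h₂` the ring neighbour of `h₁` right after its outer run, outer runs of `2–3` cells each, the first contact end simple; common marks `S₀`; a flat common
observed dart `bz`) and a size `#S₀ = n + 1`, it BUILDS the five marked domains of the two-cell cap identity with Bollobás–Riordan's marking at boundary darts
(`TriMarkedDomain.ofDarts`, rebased at `bz`) and proves the identity for their lawpoints.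

* §1 `TwoCellDarts`; the junction identities; ★ `slideDarts₁` — **the first attachment `G ⊂ G ∪ {h₁}` IS slide data** `SlideDarts D₀ D₁ h₁ r₁ (m₁ + 1) bz S₀` whose `Q`-dart is
  the `c`-dart `dc = (s, h₂)` (`dc_eq_slideQ`) — so «SLIDE-OF-DARTS» / «CONTRACT-OF-DARTS» supply `D = (Ω; M)` (`domD`), `E_Pc = (Ω; M + p + c)` (`domPc`), the insertion index
  `jIns`, `marksData`, the arc points `arcPoint0` / `arcPointPQ`;
* §2 `removableAt₂` (`h₂` removable from `G ∪ {h₁, h₂}`, block `m₂ + 1`, offset-`5` neighbour `h₁`); ★ `dpos_lt_iff₂₁` / `dpos_lt_iff₁₀` («ATTACH-ORDER» twice: common darts compare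
  identically in the three domains); ★ `dpos_lt_da_iff` (`d < da` in `G ∪ {h₁, h₂}` iff `d < dc` in `G`), ★ `dpos_lt_db_iff` (`d < db` iff `d < dQ`);
* §3 markability: `isMarkable_dQ` / `isMarkable_dc` / `isMarkable_dP` (in `G`), `isMarkable_da` / `isMarkable_db` (in `G ∪ {h₁, h₂}`);
* §4 ★★ `dpos_dc_dQ`, ★★ `dpos_marks` — **IN `G` THE THREE NEW MARKS ARE CONSECUTIVE**: `dP < dc < dQ`, a common mark precedes one iff it precedes all (the darts between are the
  contact-arc darts into `h₁`, `h₂`: `succ_nw₂`, `succ_nw₂_last`);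
* §5 the marked sets (`setW`, `setPQ`, `setCQ`; `triDir_add_triDir_eq_triDir` for distinct tails), the domains `domW = (Ω ∪ h₁ ∪ h₂; M + a + b)`, `domPQ`, `domCQ`; the insertion
  enumeration `insFn` and its criterion `insFn_strictMono`; ★★ `markDart_domW` / `markDart_domPQ` / `markDart_domCQ` — **`da, db` (resp. `dP, dQ`; `dc, dQ`) sit at the indices
  `j⁺, j+1` of the SAME insertion index `j`, the common marks at `skip j`** (`dpos_da_lt_db`);
* §6 the corner faces: `yc_domW_skip` (the predecessor dart of a common mark avoids both notches, `predDart_mem₂`), `yc_domPQ_skip`, `yc_domCQ_skip`; ★ `yc_domW_ends` (`a = N¹_0`,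
  `b = N²_0`), `yc_domPQ_ends` (`P`, `Q`), `yc_domCQ_ends` (`c = N¹_{m₁+1}`, `Q`);
* §7 `bz_mem_stretch`, `arcPointW` / `arcPointPQ` / `arcPointCQ`, `arcPoint_v_i`;
* §8 ★★ `twoCellData : TwoCellData domW domD h₁ h₂ r₁ m₁ 0 r₂ m₂ 0 j⁺ (j+1) j`, ★ `marksPQ` / `marksPc` / `marksCQ`, and ★★★★ `TwoCellDarts.lawLP_eq_twoCellCap` —
  **`lawLP z(Ω∪h₁∪h₂; M+a+b) = capInsL j⁺ (lawLP z(Ω; M)) + lawLP z(Ω; M+p+q) + lawLP z(Ω; M+p+c) + lawLP z(Ω; M+c+q)` for the CONSTRUCTED lawpoints.**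

So the lane's three surgery identities — SLIDE (#848/#879), F2 (#937/#945), TWO-CELL CAP (p573050 / this file) — are all theorems about constructed lawpoints of one family
(HOME `FINDING-BSPAN-SLIDE-INDUCTION.md`, `FINDING-TWO-CELL-CAP-IDENTITY.md`): the BR-compatible surgery algebra of the BSPAN-by-towers programme.

## References
* M. Khristoforov, S. Smirnov, *Percolation and O(1) loop model*, arXiv:2111.15612v1 (2021), §1.2 (p. 2: the law of the link pattern; disorders on the boundary), §2
  Definition 3 and Remark 6 (pp. 4–5: boundary mid-edges), eq. (4) (p. 5).
* B. Bollobás, O. Riordan, *Percolation*, Cambridge University Press 2006, Ch. 7 §7.2.2 pp. 168–169 (discrete domains; the anticlockwise boundary walk; marked sites at their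
  second outside neighbour, in anticlockwise order).
* P. A. Pearce, V. Rittenberg, J. de Gier, B. Nienhuis, *Temperley–Lieb stochastic processes*, J. Phys. A 35 (2002) L661–L668, §2 ((monoid): the cup–cap).

## Mathlib / tree
Tree: `MarkedLoopLawTwoCellCap` (`TwoCellData.lawLP_eq_twoCellCap`, `TwoCellMarks`), `MarkedLoopLawContractOfDarts` (`SlideDarts.dom0/domPQ/jIns/marksData/markDart_dom0_mem/
dpos_markDart_dom0_strictMono/dpos_markDart_lt_dP_iff/dpos_dP_lt_dQ/markDart_dom0'_eq/predDart_dom0'_eq/yc_domPQ_ends/arcPoint0/arcPointPQ/arcPoint_v_i₀/skip_lt_castSucc_iff`),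
`MarkedLoopLawSlideOfDarts` (`SlideDarts`, `slideA/P/Q`, `removableAt`, `dQ_eq_dPlus`, `da_eq_blk`, `isMarkable_dP/dQ`, `bz_mem'`, `leftFaceDir_contactQ`), `TriMarkedDomainAttach`
(`rebase₀`, `dpos_lt_dpos_iff_of_common`, `dpos_lt_blk_iff`, `mem_bdry₁_of_common`, `ofDarts_markDart_eq_of_strictMono`, `dpos_ofDarts_markDart`, `predDart_eq_of_succ_eq`,
`yc_eq_leftFaceDir`), `TriMarkedDomainOfDarts(Stretch)` (`ofDarts`, `ofDarts_markDart_mem`, `mem_stretch_ofDarts_last_iff`), `TriDiscShelling` (`RemovableAt.*`: `nw`, `blk`,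
`dPlus`, `dMinus`, `succ_erase_eq/_nw/_nw_last`, `dPlus_mem_erase`, `out`), `TriMarkedRingLocal` (`isMarkable_of_ring`, `add_triDir_add_triDir_add_four`), `TriDiscInterface`
(`dpos_succ`, `iter_dpos`, `dpos_lt`, `dpos_eq_of_iter_eq`), `MarkedLoopArcPointOfDart` (`ArcPoint.ofFlatDart`, `ofFlatDart_v`, `side_ofFlatDart`),
`LatticeModels/TemperleyLiebCapContract` (`skip`, `unskip`, `skip_lt_iff`). Mathlib: `Finset.insert_comm`, `Finset.card_insert_of_notMem`.
-/

open Finset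

namespace Literature.Probability.Percolation.MarkedLoops

open Literature.Probability.Percolation Literature.Probability.LatticeModels
open Literature.Probability.LatticeModels.TemperleyLieb
open Literature.Probability.Percolation.FivePoint (side side_injective)
open TriMarkedDomain

section TwoCellOfDarts

/-- **the mark at the inner junction `c`**: `dc = (s, h₂)` with `s = h₂ + e_{r₂+4}` the common contact cell (the second outside neighbour of `s` after `h₁`).
[cite: BollobasRiordan2006, Ch. 7 §7.2.2 p. 169; lane tool notion] -/
def dartC (h₂ : Site 2) (r₂ : Fin 6) : Site 2 × Site 2 := (h₂ + triDir (r₂ + 4), h₂)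

/-- **TWO-CELL DATA IN COORDINATES.** Three unmarked discrete domains `D₀` on `G`, `D₁` on `G ∪ {h₁}`, `D₂` on `G ∪ {h₁, h₂}` (`h₁, h₂ ∉ G` adjacent, `h₂` at offset `m₁ + 1` of
the ring of `h₁`: outer cells of `h₁` at offsets `k ≤ m₁` from `r₁`, contact cells at `k ≥ m₁ + 2`; outer cells of `h₂` at offsets `k ≤ m₂` from `r₂ = r₁ + m₁ + 5`, contact
cells at `m₂ < k ≤ 4`; `1 ≤ m₁ ≤ 2`, `1 ≤ m₂ ≤ 2`; the first contact end simple), a common boundary dart `bz` (flat, off the notch, not a mark), and common marks `S₀` (boundary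
darts of `G` with heads off `h₁, h₂`, markable in `G`, in `G ∪ {h₁}` and in `G ∪ {h₁, h₂}`, tails pairwise distinct and off the three contact cells carrying `P`, `c`, `Q`, not containing the
`Q`- and `c`-darts). [cite: BollobasRiordan2006, Ch. 7 §7.2.2 pp. 168–169; KhristoforovSmirnov2021, §1.2 (arXiv v1 p. 2)] -/
structure TwoCellDarts (D₀ D₁ D₂ : TriMarkedDomain 0) (h₁ h₂ : Site 2) (r₁ m₁ r₂ m₂ : Fin 6) (bz : Site 2 × Site 2) (S₀ : Finset (Site 2 × Site 2)) : Prop where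
  /-- the middle domain is `G ∪ {h₁}` -/
  verts₁ : D₁.verts = insert h₁ D₀.verts
  /-- the big domain is `G ∪ {h₁, h₂}` -/
  verts₂ : D₂.verts = insert h₂ D₁.verts
  /-- `h₁` is new -/
  notMem₁ : h₁ ∉ D₀.verts
  /-- `h₂` is new -/
  notMem₂ : h₂ ∉ D₀.verts
  /-- `h₂` is the ring neighbour of `h₁` right after its outer run -/
  h₂_eq : h₂ = h₁ + triDir (r₁ + (m₁ + 1))
  /-- the ring base of `h₂` -/
  r₂_eq : r₂ = r₁ + (m₁ + 5)
  /-- the outer run of `h₁` -/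
  out₁ : ∀ k : Fin 6, k ≤ m₁ → h₁ + triDir (r₁ + k) ∉ D₀.verts
  /-- the contact arc of `h₁` -/
  in₁ : ∀ k : Fin 6, m₁ + 1 < k → h₁ + triDir (r₁ + k) ∈ D₀.verts
  /-- the outer run of `h₂` -/
  out₂ : ∀ k : Fin 6, k ≤ m₂ → h₂ + triDir (r₂ + k) ∉ D₀.verts
  /-- the contact arc of `h₂` -/
  in₂ : ∀ k : Fin 6, m₂ < k → k ≠ 5 → h₂ + triDir (r₂ + k) ∈ D₀.verts
  /-- at least two outer-path bonds on `h₁` -/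
  one_le₁ : 1 ≤ m₁.val
  /-- the run of the common contact cell starts at `h₁` (the junction `c` is markable) -/
  m₁_le : m₁.val ≤ 2
  /-- at least two outer-path bonds on `h₂` -/
  one_le₂ : 1 ≤ m₂.val
  /-- the run of the common contact cell ends at `h₂` (the sites of `c` and `Q` differ) -/
  m₂_le : m₂.val ≤ 2
  /-- the first contact end `P` is a simple convex corner of `G` -/
  simpleP : h₁ + triDir (r₁ + 5) + triDir r₁ ∈ D₀.verts
  /-- the observed dart is a boundary dart of `G` … -/
  bz_mem : bz ∈ triBdryDarts D₀.verts
  /-- … common to the bigger domains … -/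
  bz_snd : bz.2 ≠ h₁ ∧ bz.2 ≠ h₂
  /-- … other than the `Q`- and `c`-darts … -/
  bz_ne : bz ≠ slideQ h₂ r₂ m₂ ∧ bz ≠ dartC h₂ r₂
  /-- … not a mark … -/
  bz_not_mem : bz ∉ S₀
  /-- … and flat -/
  flat : triLeftApex bz.1 bz.2 ∈ D₀.verts ∧ triLeftApex bz.2 bz.1 ∈ D₀.verts
  /-- the common marks are boundary darts of `G` with heads off `h₁, h₂` -/
  sub : ∀ d ∈ S₀, d ∈ triBdryDarts D₀.verts ∧ d.2 ≠ h₁ ∧ d.2 ≠ h₂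
  /-- markable in `G` -/
  mark : ∀ d ∈ S₀, IsMarkable D₀.verts d
  /-- markable in `G ∪ {h₁}` -/
  mark₁ : ∀ d ∈ S₀, IsMarkable D₁.verts d
  /-- markable in `G ∪ {h₁, h₂}` -/
  mark₂ : ∀ d ∈ S₀, IsMarkable D₂.verts d
  /-- tails pairwise distinct … -/
  inj : Set.InjOn Prod.fst (S₀ : Set (Site 2 × Site 2))
  /-- … and off the three contact cells carrying the new marks -/
  fst_ne : ∀ d ∈ S₀, d.1 ≠ (slideP h₁ r₁).1 ∧ d.1 ≠ (slideQ h₂ r₂ m₂).1 ∧ d.1 ≠ (dartC h₂ r₂).1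
  /-- the `Q`-dart is not a common mark -/
  dQ_not_mem : slideQ h₂ r₂ m₂ ∉ S₀
  /-- the `c`-dart is not a common mark -/
  dc_not_mem : dartC h₂ r₂ ∉ S₀

namespace TwoCellDarts

variable {D₀ D₁ D₂ : TriMarkedDomain 0} {h₁ h₂ : Site 2} {r₁ m₁ r₂ m₂ : Fin 6} {bz : Site 2 × Site 2} {S₀ : Finset (Site 2 × Site 2)}
  (T : TwoCellDarts D₀ D₁ D₂ h₁ h₂ r₁ m₁ r₂ m₂ bz S₀)
include T

/-! ## §1 Sites, the junction identities, the first attachment as slide data -/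

/-- `h₁ ∈ G ∪ {h₁}`. [cite: BollobasRiordan2006, Ch. 7 §7.2.2 p. 168] -/
theorem h₁_mem₁ : h₁ ∈ D₁.verts := by rw [T.verts₁]; exact Finset.mem_insert_self _ _

/-- `h₁ ∈ G ∪ {h₁, h₂}`. [cite: BollobasRiordan2006, Ch. 7 §7.2.2 p. 168] -/
theorem h₁_mem₂ : h₁ ∈ D₂.verts := by rw [T.verts₂]; exact Finset.mem_insert_of_mem T.h₁_mem₁

/-- `h₂ ∈ G ∪ {h₁, h₂}`. [cite: BollobasRiordan2006, Ch. 7 §7.2.2 p. 168] -/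
theorem h₂_mem₂ : h₂ ∈ D₂.verts := by rw [T.verts₂]; exact Finset.mem_insert_self _ _

/-- `h₁ ≠ h₂`. [cite: BollobasRiordan2006, Ch. 7 §7.2.2 p. 168] -/
private theorem h₁_ne_h₂ : h₁ ≠ h₂ := by rw [T.h₂_eq]; exact fun e => add_triDir_ne h₁ _ e.symm

/-- `h₂ ∉ G ∪ {h₁}`. [cite: BollobasRiordan2006, Ch. 7 §7.2.2 p. 168] -/
theorem h₂_notMem₁ : h₂ ∉ D₁.verts := by
  rw [T.verts₁, Finset.mem_insert, not_or]; exact ⟨T.h₁_ne_h₂.symm, T.notMem₂⟩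

/-- `G ⊆ G ∪ {h₁} ⊆ G ∪ {h₁, h₂}`. [cite: BollobasRiordan2006, Ch. 7 §7.2.2 p. 168] -/
theorem verts_subset : D₀.verts ⊆ D₁.verts ∧ D₁.verts ⊆ D₂.verts :=
  ⟨by rw [T.verts₁]; exact Finset.subset_insert _ _, by rw [T.verts₂]; exact Finset.subset_insert _ _⟩

/-- `G = (G ∪ {h₁}) ∖ h₁`, `G ∪ {h₁} = (G ∪ {h₁, h₂}) ∖ h₂`. [cite: BollobasRiordan2006, Ch. 7 §7.2.2 p. 168] -/
theorem verts_eq_erase : D₀.verts = D₁.verts.erase h₁ ∧ D₁.verts = D₂.verts.erase h₂ := by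
  rw [T.verts₂, Finset.erase_insert T.h₂_notMem₁, T.verts₁, Finset.erase_insert T.notMem₁]; exact ⟨rfl, rfl⟩

/-- `h₁` is the cell at offset `5` around `h₂` (private copy of «TWO-CELL-RING» `TwoCellData.h₁_eq` for the dart datum). [cite: BollobasRiordan2006, Ch. 7 §7.2.2 p. 168] -/
private theorem h₁_eq : h₂ + triDir (r₂ + 5) = h₁ := by
  rw [T.r₂_eq, T.h₂_eq, show r₁ + (m₁ + 5) + 5 = r₁ + (m₁ + 1) + 3 by omega, add_triDir_add_triDir_add_three']

/-- the first outer cell of `h₂` is the last outer cell of `h₁`. [cite: BollobasRiordan2006, Ch. 7 §7.2.2 p. 168] -/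
private theorem o_eq : h₂ + triDir r₂ = h₁ + triDir (r₁ + m₁) := by
  rw [T.r₂_eq, T.h₂_eq, show r₁ + (m₁ + 5) = r₁ + (m₁ + 1) + 4 by omega, add_triDir_add_triDir_add_four, show r₁ + (m₁ + 1) + 5 = r₁ + m₁ by omega]

/-- the common contact cell `s`: offset `4` around `h₂`, offset `m₁ + 2` around `h₁`. [cite: BollobasRiordan2006, Ch. 7 §7.2.2 p. 168] -/
private theorem s_eq : h₂ + triDir (r₂ + 4) = h₁ + triDir (r₁ + (m₁ + 2)) := by
  rw [T.r₂_eq, T.h₂_eq, show r₁ + (m₁ + 5) + 4 = r₁ + (m₁ + 1) + 2 by omega, add_triDir_add_triDir_add_two', show r₁ + (m₁ + 1) + 1 = r₁ + (m₁ + 2) by omega]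

/-- ★ **the `c`-dart is the `Q`-dart of the first attachment**: `dc = (s, h₂) = slideQ h₁ r₁ (m₁ + 1)`. [cite: BollobasRiordan2006, Ch. 7 §7.2.2 p. 169; lane plumbing] -/
theorem dc_eq_slideQ : dartC h₂ r₂ = slideQ h₁ r₁ (m₁ + 1) := by
  unfold dartC slideQ
  rw [T.s_eq, ← T.h₂_eq, show r₁ + (m₁ + 1 + 1) = r₁ + (m₁ + 2) by omega]

/-- ★★ **THE FIRST ATTACHMENT IS SLIDE DATA**: `h₁` attached to `G` has the outer run `k ≤ m₁ + 1` (its last cell being the slot of `h₂`), its `Q`-dart is the `c`-dart.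
[cite: BollobasRiordan2006, Ch. 7 §7.2.2 pp. 168–169; KhristoforovSmirnov2021, §1.2 (arXiv v1 p. 2)] -/
theorem slideDarts₁ : SlideDarts D₀ D₁ h₁ r₁ (m₁ + 1) bz S₀ where
  verts' := T.verts₁
  not_mem := T.notMem₁
  out := fun k hk => by
    have hm := T.m₁_le
    rcases (show k ≤ m₁ ∨ k = m₁ + 1 by omega) with hk' | rfl
    · exact T.out₁ k hk'
    · rw [← T.h₂_eq]; exact T.notMem₂
  inside := fun k hk => T.in₁ k hk
  one_le := by have := T.one_le₁; have := T.m₁_le; omega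
  m_le := by have := T.m₁_le; omega
  simpleP := T.simpleP
  bz_mem := T.bz_mem
  bz_snd := T.bz_snd.1
  bz_ne := by rw [← T.dc_eq_slideQ]; exact T.bz_ne.2
  bz_not_mem := T.bz_not_mem
  flat := T.flat
  sub := fun d hd => ⟨(T.sub d hd).1, (T.sub d hd).2.1⟩
  mark := T.mark
  mark' := T.mark₁
  inj := T.inj
  fst_ne := fun d hd => ⟨by rw [← T.dc_eq_slideQ]; exact (T.fst_ne d hd).2.2, (T.fst_ne d hd).1⟩
  dQ_not_mem := by rw [← T.dc_eq_slideQ]; exact T.dc_not_mem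

/-! ## §2 The second attachment: `h₂` is removable from `G ∪ {h₁, h₂}`; common darts compare identically in the three domains -/

/-- ★ **`h₂` is a removable hexagon of `G ∪ {h₁, h₂}`** with the block of `m₂ + 1` outside neighbours from offset `r₂` (its offset-`5` neighbour is `h₁`).
[cite: BollobasRiordan2006, Ch. 7 §7.2.2 p. 168] -/
theorem removableAt₂ : RemovableAt D₂.verts h₂ r₂ (m₂ + 1) where
  mem := T.h₂_mem₂
  one_le := by have := T.m₂_le; omega
  out_iff := by
    intro t
    have hm := T.m₂_le
    have e1 : (m₂ + 1).val = m₂.val + 1 := by omega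
    rw [T.verts₂, T.verts₁, Finset.mem_insert, Finset.mem_insert, not_or, not_or, e1]
    constructor
    · rintro ⟨-, h1, ht⟩
      by_contra hlt
      by_cases h5 : t = 5
      · subst h5; exact h1 T.h₁_eq
      · exact ht (T.in₂ t (by rw [Fin.lt_def]; omega) h5)
    · intro ht
      refine ⟨fun e => add_triDir_ne h₂ _ e, fun e => ?_, T.out₂ t (by rw [Fin.le_def]; omega)⟩
      rw [← T.h₁_eq] at e
      have := add_left_cancel (triDir_injective (add_left_cancel e))
      omega

/-- the observed dart is a dart of `∂(G ∪ {h₁})` with tail off `h₁`. [cite: BollobasRiordan2006, Ch. 7 §7.2.2 p. 168] -/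
theorem bz_mem₁ : bz ∈ triBdryDarts D₁.verts ∧ bz.1 ≠ h₁ := T.slideDarts₁.bz_mem'

/-- the observed dart is a dart of `∂(G ∪ {h₁, h₂})` with tail off `h₂` and off `h₁`. [cite: BollobasRiordan2006, Ch. 7 §7.2.2 p. 168] -/
theorem bz_mem₂ : bz ∈ triBdryDarts D₂.verts ∧ bz.1 ≠ h₂ ∧ bz.1 ≠ h₁ := by
  obtain ⟨h1, h2, h3⟩ := mem_triBdryDarts.1 T.bz_mem₁.1
  refine ⟨mem_triBdryDarts.2 ⟨T.verts_subset.2 h1, ?_, h3⟩, fun e => T.h₂_notMem₁ (e ▸ h1), T.bz_mem₁.2⟩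
  rw [T.verts₂, Finset.mem_insert, not_or]; exact ⟨T.bz_snd.2, h2⟩

omit T in
/-- `dQ` is `dPlus` of the removable `h₂` (a `T`-free copy of «SLIDE-OF-DARTS» `dQ_eq_dPlus`). [cite: BollobasRiordan2006, Ch. 7 §7.2.2 p. 168; lane plumbing] -/
private theorem dQ_eq_dPlus : slideQ h₂ r₂ m₂ = RemovableAt.dPlus h₂ r₂ (m₂ + 1) := by
  unfold slideQ RemovableAt.dPlus
  rw [show m₂ + 1 - 1 = m₂ by omega]

/-- `dc` is `dPlus` of the removable `h₁` (first attachment). [cite: BollobasRiordan2006, Ch. 7 §7.2.2 p. 168; lane plumbing] -/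
theorem dc_eq_dPlus : dartC h₂ r₂ = RemovableAt.dPlus h₁ r₁ (m₁ + 1 + 1) := by rw [T.dc_eq_slideQ]; exact T.slideDarts₁.dQ_eq_dPlus

/-- **a common mark is a boundary dart of all three domains, with tail off `h₁` and `h₂`.** [cite: BollobasRiordan2006, Ch. 7 §7.2.2 p. 168] -/
theorem common_of_mem {d : Site 2 × Site 2} (hd : d ∈ S₀) :
    d ∈ triBdryDarts D₂.verts ∧ d ∈ triBdryDarts D₁.verts ∧ d ∈ triBdryDarts D₀.verts ∧ d.1 ≠ h₁ ∧ d.1 ≠ h₂ := by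
  obtain ⟨hd0, hd1, hd2⟩ := T.sub d hd
  obtain ⟨hx, hy, hadj⟩ := mem_triBdryDarts.1 hd0
  have hxh₁ : d.1 ≠ h₁ := fun e => T.notMem₁ (e ▸ hx)
  have hxh₂ : d.1 ≠ h₂ := fun e => T.notMem₂ (e ▸ hx)
  refine ⟨mem_triBdryDarts.2 ⟨T.verts_subset.2 (T.verts_subset.1 hx), ?_, hadj⟩, mem_triBdryDarts.2 ⟨T.verts_subset.1 hx, ?_, hadj⟩, hd0, hxh₁, hxh₂⟩
  · rw [T.verts₂, Finset.mem_insert, not_or, T.verts₁, Finset.mem_insert, not_or]; exact ⟨hd2, hd1, hy⟩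
  · rw [T.verts₁, Finset.mem_insert, not_or]; exact ⟨hd1, hy⟩

/-- ★ **common darts compare identically in `G ∪ {h₁, h₂}` and `G ∪ {h₁}`** (tails off `h₂`). [cite: BollobasRiordan2006, Ch. 7 §7.2.2 p. 168 (the boundary cycle)] -/
theorem dpos_lt_iff₂₁ {d d' : Site 2 × Site 2} (hd : d ∈ triBdryDarts D₂.verts) (hdh : d.1 ≠ h₂) (hd' : d' ∈ triBdryDarts D₂.verts) (hdh' : d'.1 ≠ h₂) :
    (D₂.rebase₀ T.bz_mem₂.1).dpos d < (D₂.rebase₀ T.bz_mem₂.1).dpos d' ↔ (D₁.rebase₀ T.bz_mem₁.1).dpos d < (D₁.rebase₀ T.bz_mem₁.1).dpos d' :=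
  dpos_lt_dpos_iff_of_common (D' := D₂.rebase₀ T.bz_mem₂.1) (D₁ := D₁.rebase₀ T.bz_mem₁.1) T.removableAt₂ T.verts_eq_erase.2 rfl T.bz_mem₂.2.1
    (by rw [← dQ_eq_dPlus]; exact T.bz_ne.1) hd hdh hd' hdh'

/-- ★ **common darts compare identically in `G ∪ {h₁}` and `G`** (tails off `h₁`). [cite: BollobasRiordan2006, Ch. 7 §7.2.2 p. 168 (the boundary cycle)] -/
theorem dpos_lt_iff₁₀ {d d' : Site 2 × Site 2} (hd : d ∈ triBdryDarts D₁.verts) (hdh : d.1 ≠ h₁) (hd' : d' ∈ triBdryDarts D₁.verts) (hdh' : d'.1 ≠ h₁) :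
    (D₁.rebase₀ T.bz_mem₁.1).dpos d < (D₁.rebase₀ T.bz_mem₁.1).dpos d' ↔ (D₀.rebase₀ T.bz_mem).dpos d < (D₀.rebase₀ T.bz_mem).dpos d' :=
  dpos_lt_dpos_iff_of_common (D' := D₁.rebase₀ T.bz_mem₁.1) (D₁ := D₀.rebase₀ T.bz_mem) T.slideDarts₁.removableAt T.verts_eq_erase.1 rfl T.bz_mem₁.2
    (by rw [← T.dc_eq_dPlus]; exact T.bz_ne.2) hd hdh hd' hdh'

/-- `da` is a dart of `∂(G ∪ {h₁, h₂})` and of `∂(G ∪ {h₁})`. [cite: BollobasRiordan2006, Ch. 7 §7.2.2 p. 168] -/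
theorem da_mem : slideA h₁ r₁ ∈ triBdryDarts D₂.verts ∧ slideA h₁ r₁ ∈ triBdryDarts D₁.verts := by
  have R := T.slideDarts₁.removableAt
  have h1 : h₁ + triDir (r₁ + 1) ∉ D₁.verts := R.out (t := 1) (by have := T.one_le₁; have := T.m₁_le; simp; omega)
  refine ⟨mem_triBdryDarts.2 ⟨T.h₁_mem₂, ?_, triGraph_adj_add_triDir _ _⟩, mem_triBdryDarts.2 ⟨T.h₁_mem₁, h1, triGraph_adj_add_triDir _ _⟩⟩
  rw [T.verts₂, Finset.mem_insert, not_or]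
  refine ⟨fun e => ?_, h1⟩
  rw [T.h₂_eq] at e
  have := add_left_cancel (triDir_injective (add_left_cancel e))
  have := T.one_le₁; have := T.m₁_le; omega

/-- ★ **a common dart precedes `da` in `G ∪ {h₁, h₂}` iff it precedes `dc` in `G`** (the block of `h₁` and `dc = dPlus` occupy the same slot).
[cite: BollobasRiordan2006, Ch. 7 §7.2.2 p. 168 (the boundary cycle); KhristoforovSmirnov2021, §1.2 (arXiv v1 p. 2: marked points in cyclic order)] -/
theorem dpos_lt_da_iff {d : Site 2 × Site 2} (hd : d ∈ triBdryDarts D₂.verts) (hdh₁ : d.1 ≠ h₁) (hdh₂ : d.1 ≠ h₂) :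
    (D₂.rebase₀ T.bz_mem₂.1).dpos d < (D₂.rebase₀ T.bz_mem₂.1).dpos (slideA h₁ r₁) ↔ (D₀.rebase₀ T.bz_mem).dpos d < (D₀.rebase₀ T.bz_mem).dpos (dartC h₂ r₂) := by
  have hd₁ : d ∈ triBdryDarts D₁.verts := mem_bdry₁_of_common (D' := D₂.rebase₀ T.bz_mem₂.1) (D₁ := D₁.rebase₀ T.bz_mem₁.1) T.verts_eq_erase.2 hd hdh₂
  rw [T.dpos_lt_iff₂₁ hd hdh₂ T.da_mem.1 T.h₁_ne_h₂, SlideDarts.da_eq_blk (h := h₁) (r := r₁), T.dc_eq_dPlus]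
  exact dpos_lt_blk_iff (D' := D₁.rebase₀ T.bz_mem₁.1) (D₁ := D₀.rebase₀ T.bz_mem) T.slideDarts₁.removableAt T.verts_eq_erase.1 rfl T.bz_mem₁.2
    (by rw [← T.dc_eq_dPlus]; exact T.bz_ne.2) hd₁ hdh₁ 1 (by have := T.one_le₁; have := T.m₁_le; simp; omega)

/-- `dQ` is a boundary dart of `G ∪ {h₁}` and of `G`, with tail off `h₁`. [cite: BollobasRiordan2006, Ch. 7 §7.2.2 p. 168] -/
theorem dQ_mem : slideQ h₂ r₂ m₂ ∈ triBdryDarts D₁.verts ∧ slideQ h₂ r₂ m₂ ∈ triBdryDarts D₀.verts ∧ (slideQ h₂ r₂ m₂).1 ≠ h₁ := by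
  have h1 : slideQ h₂ r₂ m₂ ∈ triBdryDarts D₁.verts := by rw [dQ_eq_dPlus, T.verts_eq_erase.2]; exact T.removableAt₂.dPlus_mem_erase
  have hx : (slideQ h₂ r₂ m₂).1 ≠ h₁ := by
    unfold slideQ
    intro e
    have e' : h₂ + triDir (r₂ + (m₂ + 1)) = h₂ + triDir (r₂ + 5) := by rw [T.h₁_eq]; exact e
    have := add_left_cancel (triDir_injective (add_left_cancel e'))
    have := T.m₂_le; omega
  exact ⟨h1, mem_bdry₁_of_common (D' := D₁.rebase₀ T.bz_mem₁.1) (D₁ := D₀.rebase₀ T.bz_mem) T.verts_eq_erase.1 h1 hx, hx⟩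

/-- ★ **a common dart precedes `db` in `G ∪ {h₁, h₂}` iff it precedes `dQ` in `G`.** [cite: BollobasRiordan2006, Ch. 7 §7.2.2 p. 168 (the boundary cycle)] -/
theorem dpos_lt_db_iff {d : Site 2 × Site 2} (hd : d ∈ triBdryDarts D₂.verts) (hdh₁ : d.1 ≠ h₁) (hdh₂ : d.1 ≠ h₂) :
    (D₂.rebase₀ T.bz_mem₂.1).dpos d < (D₂.rebase₀ T.bz_mem₂.1).dpos (slideA h₂ r₂) ↔ (D₀.rebase₀ T.bz_mem).dpos d < (D₀.rebase₀ T.bz_mem).dpos (slideQ h₂ r₂ m₂) := by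
  have hd₁ : d ∈ triBdryDarts D₁.verts := mem_bdry₁_of_common (D' := D₂.rebase₀ T.bz_mem₂.1) (D₁ := D₁.rebase₀ T.bz_mem₁.1) T.verts_eq_erase.2 hd hdh₂
  rw [SlideDarts.da_eq_blk (h := h₂) (r := r₂), dpos_lt_blk_iff (D' := D₂.rebase₀ T.bz_mem₂.1) (D₁ := D₁.rebase₀ T.bz_mem₁.1) T.removableAt₂ T.verts_eq_erase.2 rfl T.bz_mem₂.2.1
    (by rw [← dQ_eq_dPlus]; exact T.bz_ne.1) hd hdh₂ 1 (by have := T.one_le₂; have := T.m₂_le; simp; omega), ← dQ_eq_dPlus]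
  exact T.dpos_lt_iff₁₀ hd₁ hdh₁ T.dQ_mem.1 T.dQ_mem.2.2

/-! ## §3 The five new darts are markable -/

/-- ★ `dQ` is markable in `G` (the walk enters `h₂ + e_{r₂+m₂+1}` from `h₂ + e_{r₂+m₂+2}`, turns at `h₂`, then at `h₂ + e_{r₂+m₂}`). [cite: BollobasRiordan2006, Ch. 7 §7.2.2 p. 169] -/
theorem isMarkable_dQ : IsMarkable D₀.verts (slideQ h₂ r₂ m₂) := by
  have hm := T.m₂_le
  set J₀ := r₂ + (m₂ + 1) with hJ₀
  set g := h₂ + triDir J₀ with hg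
  have hgm : g ∈ D₀.verts := T.in₂ (m₂ + 1) (by omega) (by omega)
  have e2 : g + triDir (J₀ + 3 + 5) = h₂ + triDir (r₂ + (m₂ + 2)) := by
    rw [show J₀ + 3 + 5 = J₀ + 2 by omega, hg, add_assoc h₂, triDir_add_triDir_add_two, hJ₀, show r₂ + (m₂ + 1) + 1 = r₂ + (m₂ + 2) by omega]
  have e3 : g + triDir (J₀ + 3) = h₂ := by rw [hg, add_triDir_add_triDir_add_three']
  have e4 : g + triDir (J₀ + 3 + 1) = h₂ + triDir (r₂ + m₂) := by
    rw [show J₀ + 3 + 1 = J₀ + 4 by omega, hg, add_triDir_add_triDir_add_four, hJ₀, show r₂ + (m₂ + 1) + 5 = r₂ + m₂ by omega]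
  have hmk := isMarkable_of_ring (G := D₀.verts) (g := g) (J₀ + 3) hgm (by rw [e2]; exact T.in₂ (m₂ + 2) (by omega) (by omega)) (by rw [e3]; exact T.notMem₂)
    (by rw [e4]; exact T.out₂ m₂ le_rfl)
  rwa [e4] at hmk

/-- ★ `dc` is markable in `G` (it is the `Q`-dart of the first attachment). [cite: BollobasRiordan2006, Ch. 7 §7.2.2 p. 169] -/
theorem isMarkable_dc : IsMarkable D₀.verts (dartC h₂ r₂) := by rw [T.dc_eq_slideQ]; exact T.slideDarts₁.isMarkable_dQ

/-- ★ `dP` is markable in `G`. [cite: BollobasRiordan2006, Ch. 7 §7.2.2 p. 169] -/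
theorem isMarkable_dP : IsMarkable D₀.verts (slideP h₁ r₁) := T.slideDarts₁.isMarkable_dP

/-- ★ `da` is markable in `G ∪ {h₁, h₂}` (the walk enters `h₁` from `h₁ + e_{r₁+5}`, turns at `h₁ + e_{r₁}`, then at `h₁ + e_{r₁+1}`). [cite: BollobasRiordan2006, Ch. 7 §7.2.2 p. 169] -/
theorem isMarkable_da : IsMarkable D₂.verts (slideA h₁ r₁) := by
  have hm := T.m₁_le
  have h1 := T.one_le₁
  have hin : h₁ + triDir (r₁ + 5) ∈ D₂.verts := T.verts_subset.2 (T.verts_subset.1 (T.in₁ 5 (by omega)))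
  have h0 : h₁ + triDir (r₁ + 0) ∉ D₂.verts := by
    rw [T.verts₂, Finset.mem_insert, not_or, T.verts₁, Finset.mem_insert, not_or]
    refine ⟨fun e => ?_, fun e => add_triDir_ne h₁ _ e, T.out₁ 0 (Fin.zero_le _)⟩
    rw [T.h₂_eq] at e; have := add_left_cancel (triDir_injective (add_left_cancel e)); omega
  rw [add_zero] at h0
  exact isMarkable_of_ring (G := D₂.verts) (g := h₁) r₁ T.h₁_mem₂ hin h0 (mem_triBdryDarts.1 T.da_mem.1).2.1

/-- `db` is a dart of `∂(G ∪ {h₁, h₂})`. [cite: BollobasRiordan2006, Ch. 7 §7.2.2 p. 168] -/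
theorem db_mem : slideA h₂ r₂ ∈ triBdryDarts D₂.verts :=
  mem_triBdryDarts.2 ⟨T.h₂_mem₂, T.removableAt₂.out (t := 1) (by have := T.one_le₂; have := T.m₂_le; simp; omega), triGraph_adj_add_triDir _ _⟩

/-- ★ `db` is markable in `G ∪ {h₁, h₂}` (the walk enters `h₂` from `h₁`, turns at `h₂ + e_{r₂}`, then at `h₂ + e_{r₂+1}`). [cite: BollobasRiordan2006, Ch. 7 §7.2.2 p. 169] -/
theorem isMarkable_db : IsMarkable D₂.verts (slideA h₂ r₂) := by
  have R := T.removableAt₂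
  have h0 := R.out (t := 0) (by have := T.m₂_le; simp only [Fin.val_zero]; omega)
  rw [add_zero] at h0
  exact isMarkable_of_ring (G := D₂.verts) (g := h₂) r₂ T.h₂_mem₂ (by rw [T.h₁_eq]; exact T.h₁_mem₂) h0 (mem_triBdryDarts.1 T.db_mem).2.1

/-! ## §4 Positions in `G`: the marks `dP < dc < dQ` are consecutive among the common marks -/

omit T in
/-- the successor of a boundary dart advances the position by one unless it returns to the base. [cite: BollobasRiordan2006, Ch. 7 §7.2.2 p. 168 (the boundary is one cycle); lane plumbing] -/
theorem dpos_succ_eq_add_one (E : TriMarkedDomain 0) {d : Site 2 × Site 2} (hd : d ∈ triBdryDarts E.verts) (hne : triBdrySucc E.verts d ≠ E.base) :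
    E.dpos (triBdrySucc E.verts d) = E.dpos d + 1 := by
  have h := E.dpos_succ hd
  rcases Nat.lt_or_ge (E.dpos d + 1) #(triBdryDarts E.verts) with h1 | h1
  · rw [h, Nat.mod_eq_of_lt h1]
  · exfalso
    have hlt := E.dpos_lt hd
    have e : E.dpos d + 1 = #(triBdryDarts E.verts) := by omega
    have h0 : E.dpos (triBdrySucc E.verts d) = 0 := by rw [h, e, Nat.mod_self]
    apply hne
    have := E.iter_dpos (triBdrySucc_mem hd)
    rw [h0, triBdryIter_zero] at this
    exact this.symm

omit T in
/-- positions are injective on the boundary darts. [cite: BollobasRiordan2006, Ch. 7 §7.2.2 p. 168; lane plumbing] -/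
theorem eq_of_dpos_eq (E : TriMarkedDomain 0) {d d' : Site 2 × Site 2} (hd : d ∈ triBdryDarts E.verts) (hd' : d' ∈ triBdryDarts E.verts) (e : E.dpos d = E.dpos d') :
    d = d' := by
  rw [← E.iter_dpos hd, ← E.iter_dpos hd', e]

/-- the darts `(h₂ + e_{r₂+t}, h₂)`, `m₂ < t ≤ 4`, of the contact arc of `h₂` are boundary darts of `G` and of `G ∪ {h₁}`. [cite: BollobasRiordan2006, Ch. 7 §7.2.2 p. 168] -/
theorem nw₂_mem {t : Fin 6} (ht : m₂ < t) (ht5 : t ≠ 5) : RemovableAt.nw h₂ r₂ t ∈ triBdryDarts D₀.verts ∧ RemovableAt.nw h₂ r₂ t ∈ triBdryDarts D₁.verts := by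
  have hg : h₂ + triDir (r₂ + t) ∈ D₀.verts := T.in₂ t ht ht5
  have hadj : triGraph.Adj (h₂ + triDir (r₂ + t)) h₂ := by
    have := triGraph_adj_add_triDir (h₂ + triDir (r₂ + t)) (r₂ + t + 3)
    rwa [add_triDir_add_triDir_add_three'] at this
  exact ⟨mem_triBdryDarts.2 ⟨hg, T.notMem₂, hadj⟩, mem_triBdryDarts.2 ⟨T.verts_subset.1 hg, T.h₂_notMem₁, hadj⟩⟩

/-- the contact-arc darts of `h₂` are not `dMinus` of `h₁` (their head is `h₂`). [cite: BollobasRiordan2006, Ch. 7 §7.2.2 p. 168; lane plumbing] -/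
theorem nw₂_ne_dMinus (t : Fin 6) : RemovableAt.nw h₂ r₂ t ≠ RemovableAt.dMinus h₁ r₁ := by
  intro e
  have e2 := congrArg Prod.snd e
  simp only [RemovableAt.nw, RemovableAt.dMinus] at e2
  rw [T.h₂_eq] at e2
  have := triDir_injective (add_left_cancel e2)
  have := T.m₁_le; omega

/-- ★ **in `G` the contact-arc darts of `h₂` are consecutive**: `succ (nw t) = nw (t − 1)` for `m₂ + 1 < t ≤ 4`. [cite: BollobasRiordan2006, Ch. 7 §7.2.2 p. 168 (the anticlockwise walk)] -/
theorem succ_nw₂ {t : Fin 6} (ht : m₂ + 1 < t) (ht5 : t ≠ 5) : triBdrySucc D₀.verts (RemovableAt.nw h₂ r₂ t) = RemovableAt.nw h₂ r₂ (t + 5) := by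
  have hm := T.m₂_le
  rw [T.verts_eq_erase.1, T.slideDarts₁.removableAt.succ_erase_eq (T.nw₂_mem (by omega) ht5).2 (T.nw₂_ne_dMinus t), T.verts_eq_erase.2]
  exact T.removableAt₂.succ_erase_nw (by omega)

/-- ★ … and the last one is followed by `dQ`. [cite: BollobasRiordan2006, Ch. 7 §7.2.2 p. 168 (the anticlockwise walk)] -/
theorem succ_nw₂_last : triBdrySucc D₀.verts (RemovableAt.nw h₂ r₂ (m₂ + 1)) = slideQ h₂ r₂ m₂ := by
  have hm := T.m₂_le
  rw [T.verts_eq_erase.1, T.slideDarts₁.removableAt.succ_erase_eq (T.nw₂_mem (by omega) (by omega)).2 (T.nw₂_ne_dMinus _), T.verts_eq_erase.2, dQ_eq_dPlus]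
  exact T.removableAt₂.succ_erase_nw_last

omit T in
/-- `dc = nw h₂ r₂ 4`. [cite: BollobasRiordan2006, Ch. 7 §7.2.2 p. 168; lane plumbing] -/
theorem dc_eq_nw : dartC h₂ r₂ = RemovableAt.nw h₂ r₂ 4 := rfl

/-- ★★ **`dc < dQ` in `G`, with no dart between them other than the contact-arc darts of `h₂`**: a dart with head off `h₂`, other than `dQ`, precedes `dQ` iff it precedes `dc`.
[cite: BollobasRiordan2006, Ch. 7 §7.2.2 p. 168 (the boundary cycle); KhristoforovSmirnov2021, §1.2 (arXiv v1 p. 2: marked points in cyclic order)] -/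
theorem dpos_dc_dQ : (D₀.rebase₀ T.bz_mem).dpos (dartC h₂ r₂) < (D₀.rebase₀ T.bz_mem).dpos (slideQ h₂ r₂ m₂) ∧
    ∀ d ∈ triBdryDarts D₀.verts, d.2 ≠ h₂ → d ≠ slideQ h₂ r₂ m₂ →
      ((D₀.rebase₀ T.bz_mem).dpos d < (D₀.rebase₀ T.bz_mem).dpos (slideQ h₂ r₂ m₂) ↔ (D₀.rebase₀ T.bz_mem).dpos d < (D₀.rebase₀ T.bz_mem).dpos (dartC h₂ r₂)) := by
  set E := D₀.rebase₀ T.bz_mem with hE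
  have hm := T.m₂_le
  have h1 := T.one_le₂
  have hV : E.verts = D₀.verts := rfl
  have hb : E.base = bz := rfl
  have hne : ∀ t : Fin 6, RemovableAt.nw h₂ r₂ t ≠ E.base := fun t e => T.bz_snd.2 (by rw [← hb, ← e]; rfl)
  have hneQ : slideQ h₂ r₂ m₂ ≠ E.base := fun e => T.bz_ne.1 (by rw [← hb, e])
  have hmem : ∀ t : Fin 6, m₂ < t → t ≠ 5 → RemovableAt.nw h₂ r₂ t ∈ triBdryDarts E.verts := fun t ht ht5 => (T.nw₂_mem ht ht5).1
  have hQm : slideQ h₂ r₂ m₂ ∈ triBdryDarts E.verts := T.dQ_mem.2.1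
  -- the chain of positions
  have step : ∀ t : Fin 6, m₂ + 1 < t → t ≠ 5 → E.dpos (RemovableAt.nw h₂ r₂ (t + 5)) = E.dpos (RemovableAt.nw h₂ r₂ t) + 1 := by
    intro t ht ht5
    rw [← T.succ_nw₂ ht ht5]
    exact dpos_succ_eq_add_one E (hmem t (by omega) ht5) (by rw [hV, T.succ_nw₂ ht ht5]; exact hne _)
  have last : E.dpos (slideQ h₂ r₂ m₂) = E.dpos (RemovableAt.nw h₂ r₂ (m₂ + 1)) + 1 := by
    rw [← T.succ_nw₂_last]
    exact dpos_succ_eq_add_one E (hmem _ (by omega) (by omega)) (by rw [hV, T.succ_nw₂_last]; exact hneQ)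
  have hinj : ∀ d : Site 2 × Site 2, d ∈ triBdryDarts D₀.verts → d.2 ≠ h₂ → ∀ t : Fin 6, m₂ < t → t ≠ 5 → E.dpos d ≠ E.dpos (RemovableAt.nw h₂ r₂ t) := by
    intro d hd hd2 t ht ht5 e
    exact hd2 (by rw [eq_of_dpos_eq E hd (hmem t ht ht5) e]; rfl)
  rw [dc_eq_nw]
  rcases (show m₂ = 1 ∨ m₂ = 2 by omega) with hm1 | hm2
  · -- `dc = nw 4 → nw 3 → nw 2 → dQ`
    have s4 := step 4 (by rw [hm1]; decide) (by decide)
    have s3 := step 3 (by rw [hm1]; decide) (by decide)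
    rw [show (4 : Fin 6) + 5 = 3 by decide] at s4
    rw [show (3 : Fin 6) + 5 = 2 by decide] at s3
    rw [show m₂ + 1 = 2 by rw [hm1]; decide] at last
    refine ⟨by omega, fun d hd hd2 hdQ => ?_⟩
    have n4 := hinj d hd hd2 4 (by rw [hm1]; decide) (by decide)
    have n3 := hinj d hd hd2 3 (by rw [hm1]; decide) (by decide)
    have n2 := hinj d hd hd2 2 (by rw [hm1]; decide) (by decide)
    have nQ : E.dpos d ≠ E.dpos (slideQ h₂ r₂ m₂) := fun e => hdQ (eq_of_dpos_eq E hd hQm e)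
    omega
  · -- `dc = nw 4 → nw 3 → dQ`
    have s4 := step 4 (by rw [hm2]; decide) (by decide)
    rw [show (4 : Fin 6) + 5 = 3 by decide] at s4
    rw [show m₂ + 1 = 3 by rw [hm2]; decide] at last
    refine ⟨by omega, fun d hd hd2 hdQ => ?_⟩
    have n4 := hinj d hd hd2 4 (by rw [hm2]; decide) (by decide)
    have n3 := hinj d hd hd2 3 (by rw [hm2]; decide) (by decide)
    have nQ : E.dpos d ≠ E.dpos (slideQ h₂ r₂ m₂) := fun e => hdQ (eq_of_dpos_eq E hd hQm e)
    omega

/-- ★★ **THE THREE NEW MARKS OF `G` ARE CONSECUTIVE**: `dP < dc < dQ`, and a common mark precedes `dQ` iff it precedes `dc` iff it precedes `dP`.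
[cite: BollobasRiordan2006, Ch. 7 §7.2.2 p. 168 (the boundary cycle); KhristoforovSmirnov2021, §1.2 (arXiv v1 p. 2: marked points in cyclic order)] -/
theorem dpos_marks : (D₀.rebase₀ T.bz_mem).dpos (slideP h₁ r₁) < (D₀.rebase₀ T.bz_mem).dpos (dartC h₂ r₂) ∧
    (D₀.rebase₀ T.bz_mem).dpos (dartC h₂ r₂) < (D₀.rebase₀ T.bz_mem).dpos (slideQ h₂ r₂ m₂) ∧
    ∀ d ∈ S₀, ((D₀.rebase₀ T.bz_mem).dpos d < (D₀.rebase₀ T.bz_mem).dpos (dartC h₂ r₂) ↔ (D₀.rebase₀ T.bz_mem).dpos d < (D₀.rebase₀ T.bz_mem).dpos (slideP h₁ r₁)) ∧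
      ((D₀.rebase₀ T.bz_mem).dpos d < (D₀.rebase₀ T.bz_mem).dpos (slideQ h₂ r₂ m₂) ↔ (D₀.rebase₀ T.bz_mem).dpos d < (D₀.rebase₀ T.bz_mem).dpos (slideP h₁ r₁)) := by
  obtain ⟨hPc, hS⟩ := T.slideDarts₁.dpos_dP_lt_dQ
  rw [← T.dc_eq_slideQ] at hPc hS
  obtain ⟨hcQ, hS'⟩ := T.dpos_dc_dQ
  refine ⟨hPc, hcQ, fun d hd => ⟨hS d hd, ?_⟩⟩
  rw [hS' d (T.sub d hd).1 (T.sub d hd).2.2 (fun e => T.dQ_not_mem (e ▸ hd))]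
  exact hS d hd

/-! ## §5 The marked sets and the five domains -/

omit T in
/-- **the sum of two lattice directions is a direction only at angle `120°`**: `e_a + e_b = e_c ⇒ b = a ± 2`. [cite: BollobasRiordan2006, Ch. 7 §7.2.2 p. 168; lane plumbing] -/
theorem triDir_add_triDir_eq_triDir {a b c : Fin 6} (h : triDir a + triDir b = triDir c) : b = a + 2 ∨ b = a + 4 := by
  revert h; revert a b c; decide

/-- ★ **the tails of the five new darts and of the common marks are pairwise distinct** (Bollobás–Riordan: distinct marked sites): `g₅ = dP.1`, `s = dc.1`, `g' = dQ.1`, `h₁ = da.1`,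
`h₂ = db.1`. [cite: BollobasRiordan2006, Ch. 7 §7.2.2 p. 169 (distinct marked sites)] -/
theorem fst_ne₃ : (slideP h₁ r₁).1 ≠ (slideQ h₂ r₂ m₂).1 ∧ (dartC h₂ r₂).1 ≠ (slideQ h₂ r₂ m₂).1 ∧ (slideP h₁ r₁).1 ≠ (dartC h₂ r₂).1 := by
  have hm₁ := T.m₁_le
  have hm₂ := T.m₂_le
  simp only [slideP, slideQ, dartC]
  refine ⟨fun e => ?_, fun e => ?_, fun e => ?_⟩
  · rw [← T.h₁_eq, add_assoc] at e
    have e' : triDir (r₂ + 5) + triDir (r₁ + 5) = triDir (r₂ + (m₂ + 1)) := add_left_cancel e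
    have hr := T.r₂_eq
    rcases triDir_add_triDir_eq_triDir e' with h | h <;> omega
  · have := add_left_cancel (triDir_injective (add_left_cancel e)); omega
  · rw [T.s_eq] at e
    have := add_left_cancel (triDir_injective (add_left_cancel e)); omega

/-- the new darts are not common marks. [cite: BollobasRiordan2006, Ch. 7 §7.2.2 p. 169; lane plumbing] -/
theorem notMem₃ : slideA h₁ r₁ ∉ S₀ ∧ slideA h₂ r₂ ∉ S₀ ∧ slideP h₁ r₁ ∉ S₀ :=
  ⟨fun h => (T.common_of_mem h).2.2.2.1 rfl, fun h => (T.common_of_mem h).2.2.2.2 rfl, fun h => (T.sub _ h).2.1 rfl⟩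

omit T in
/-- a marked set with two new darts has pairwise distinct tails if the new tails differ from each other and from the old ones. [cite: BollobasRiordan2006, Ch. 7 §7.2.2 p. 169; lane plumbing] -/
theorem injOn_insert₂ {X Y : Site 2 × Site 2} {S : Finset (Site 2 × Site 2)} (hXY : X.1 ≠ Y.1) (hX : ∀ d ∈ S, d.1 ≠ X.1) (hY : ∀ d ∈ S, d.1 ≠ Y.1)
    (hS : Set.InjOn Prod.fst (S : Set (Site 2 × Site 2))) : Set.InjOn Prod.fst ((insert X (insert Y S) : Finset (Site 2 × Site 2)) : Set (Site 2 × Site 2)) := by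
  intro d hd d' hd' e
  rw [Finset.coe_insert, Finset.coe_insert, Set.mem_insert_iff, Set.mem_insert_iff] at hd hd'
  rcases hd with rfl | rfl | hd <;> rcases hd' with rfl | rfl | hd'
  · rfl
  · exact absurd e hXY
  · exact absurd e.symm (hX d' hd')
  · exact absurd e.symm hXY
  · rfl
  · exact absurd e.symm (hY d' hd')
  · exact absurd e (hX d hd)
  · exact absurd e (hY d hd)
  · exact hS hd hd' e

omit T in
/-- the card of a marked set with two new darts. [cite: BollobasRiordan2006, Ch. 7 §7.2.2 p. 169; lane plumbing] -/
theorem card_insert₂' {X Y : Site 2 × Site 2} {S : Finset (Site 2 × Site 2)} (hXY : X ≠ Y) (hX : X ∉ S) (hY : Y ∉ S) : #(insert X (insert Y S)) = #S + 2 := by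
  rw [Finset.card_insert_of_notMem (by rw [Finset.mem_insert, not_or]; exact ⟨hXY, hX⟩), Finset.card_insert_of_notMem hY]

/-- the marked set of `W`: pairwise distinct tails, markable, of card `#S₀ + 2`. [cite: BollobasRiordan2006, Ch. 7 §7.2.2 p. 169] -/
theorem setW : Set.InjOn Prod.fst ((insert (slideA h₁ r₁) (insert (slideA h₂ r₂) S₀) : Finset (Site 2 × Site 2)) : Set (Site 2 × Site 2)) ∧
    (∀ d ∈ insert (slideA h₁ r₁) (insert (slideA h₂ r₂) S₀), IsMarkable (D₂.rebase₀ T.bz_mem₂.1).verts d) ∧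
    #(insert (slideA h₁ r₁) (insert (slideA h₂ r₂) S₀)) = #S₀ + 2 := by
  refine ⟨injOn_insert₂ T.h₁_ne_h₂ (fun d hd => (T.common_of_mem hd).2.2.2.1) (fun d hd => (T.common_of_mem hd).2.2.2.2) T.inj, fun d hd => ?_,
    card_insert₂' (fun e => T.h₁_ne_h₂ (congrArg Prod.fst e)) T.notMem₃.1 T.notMem₃.2.1⟩
  rcases Finset.mem_insert.1 hd with rfl | hd
  · exact T.isMarkable_da
  rcases Finset.mem_insert.1 hd with rfl | hd
  · exact T.isMarkable_db
  · exact T.mark₂ d hd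

/-- the marked set of `E_PQ`. [cite: BollobasRiordan2006, Ch. 7 §7.2.2 p. 169] -/
theorem setPQ : Set.InjOn Prod.fst ((insert (slideP h₁ r₁) (insert (slideQ h₂ r₂ m₂) S₀) : Finset (Site 2 × Site 2)) : Set (Site 2 × Site 2)) ∧
    (∀ d ∈ insert (slideP h₁ r₁) (insert (slideQ h₂ r₂ m₂) S₀), IsMarkable (D₀.rebase₀ T.bz_mem).verts d) ∧
    #(insert (slideP h₁ r₁) (insert (slideQ h₂ r₂ m₂) S₀)) = #S₀ + 2 := by
  refine ⟨injOn_insert₂ T.fst_ne₃.1 (fun d hd => (T.fst_ne d hd).1) (fun d hd => (T.fst_ne d hd).2.1) T.inj, fun d hd => ?_,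
    card_insert₂' (fun e => T.fst_ne₃.1 (congrArg Prod.fst e)) T.notMem₃.2.2 T.dQ_not_mem⟩
  rcases Finset.mem_insert.1 hd with rfl | hd
  · exact T.isMarkable_dP
  rcases Finset.mem_insert.1 hd with rfl | hd
  · exact T.isMarkable_dQ
  · exact T.mark d hd

/-- the marked set of `E_cQ`. [cite: BollobasRiordan2006, Ch. 7 §7.2.2 p. 169] -/
theorem setCQ : Set.InjOn Prod.fst ((insert (dartC h₂ r₂) (insert (slideQ h₂ r₂ m₂) S₀) : Finset (Site 2 × Site 2)) : Set (Site 2 × Site 2)) ∧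
    (∀ d ∈ insert (dartC h₂ r₂) (insert (slideQ h₂ r₂ m₂) S₀), IsMarkable (D₀.rebase₀ T.bz_mem).verts d) ∧
    #(insert (dartC h₂ r₂) (insert (slideQ h₂ r₂ m₂) S₀)) = #S₀ + 2 := by
  refine ⟨injOn_insert₂ T.fst_ne₃.2.1 (fun d hd => (T.fst_ne d hd).2.2) (fun d hd => (T.fst_ne d hd).2.1) T.inj, fun d hd => ?_,
    card_insert₂' (fun e => T.fst_ne₃.2.1 (congrArg Prod.fst e)) T.dc_not_mem T.dQ_not_mem⟩
  rcases Finset.mem_insert.1 hd with rfl | hd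
  · exact T.isMarkable_dc
  rcases Finset.mem_insert.1 hd with rfl | hd
  · exact T.isMarkable_dQ
  · exact T.mark d hd

variable (n : ℕ) (hn : #S₀ = n + 1)

/-- **`D = (Ω; M)`**: `G` marked at `S₀` (the first attachment's `dom0`). [cite: BollobasRiordan2006, Ch. 7 §7.2.2 pp. 168–169; KhristoforovSmirnov2021, §1.2 (arXiv v1 p. 2)] -/
noncomputable def domD : TriMarkedDomain (n + 1) := T.slideDarts₁.dom0 n hn

/-- **`E_Pc = (Ω; M + p + c)`**: the first attachment's doubly-marked domain (its `Q`-dart is `dc`). [cite: BollobasRiordan2006, Ch. 7 §7.2.2 pp. 168–169; KhristoforovSmirnov2021, §1.2 (arXiv v1 p. 2)] -/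
noncomputable def domPc : TriMarkedDomain (n + 1 + 1 + 1) := T.slideDarts₁.domPQ n hn

/-- **`W = (Ω ∪ h₁ ∪ h₂; M + a + b)`**: `G ∪ {h₁, h₂}` marked at `S₀ ∪ {da, db}`. [cite: BollobasRiordan2006, Ch. 7 §7.2.2 pp. 168–169; KhristoforovSmirnov2021, §1.2 (arXiv v1 p. 2)] -/
noncomputable def domW : TriMarkedDomain (n + 1 + 1 + 1) :=
  (D₂.rebase₀ T.bz_mem₂.1).ofDarts (by omega) (insert (slideA h₁ r₁) (insert (slideA h₂ r₂) S₀)) (by rw [T.setW.2.2, hn]) T.setW.2.1 T.setW.1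

/-- **`E_PQ = (Ω; M + p + q)`**: `G` marked at `S₀ ∪ {dP, dQ}`. [cite: BollobasRiordan2006, Ch. 7 §7.2.2 pp. 168–169; KhristoforovSmirnov2021, §1.2 (arXiv v1 p. 2)] -/
noncomputable def domPQ : TriMarkedDomain (n + 1 + 1 + 1) :=
  (D₀.rebase₀ T.bz_mem).ofDarts (by omega) (insert (slideP h₁ r₁) (insert (slideQ h₂ r₂ m₂) S₀)) (by rw [T.setPQ.2.2, hn]) T.setPQ.2.1 T.setPQ.1

/-- **`E_cQ = (Ω; M + c + q)`**: `G` marked at `S₀ ∪ {dc, dQ}`. [cite: BollobasRiordan2006, Ch. 7 §7.2.2 pp. 168–169; KhristoforovSmirnov2021, §1.2 (arXiv v1 p. 2)] -/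
noncomputable def domCQ : TriMarkedDomain (n + 1 + 1 + 1) :=
  (D₀.rebase₀ T.bz_mem).ofDarts (by omega) (insert (dartC h₂ r₂) (insert (slideQ h₂ r₂ m₂) S₀)) (by rw [T.setCQ.2.2, hn]) T.setCQ.2.1 T.setCQ.1

/-- their sites. [cite: BollobasRiordan2006, Ch. 7 §7.2.2 p. 168; lane plumbing] -/
theorem verts₅ : (T.domD n hn).verts = D₀.verts ∧ (T.domPc n hn).verts = D₀.verts ∧ (T.domW n hn).verts = D₂.verts ∧ (T.domPQ n hn).verts = D₀.verts ∧
    (T.domCQ n hn).verts = D₀.verts := ⟨rfl, rfl, rfl, rfl, rfl⟩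

/-! ### The insertion enumeration -/

omit T hn in
/-- **the insertion enumeration**: `X` at `j⁺`, `Y` at `j+1`, the old marks around (relabelled by `skip j`). [cite: BollobasRiordan2006, Ch. 7 §7.2.2 p. 169; lane tool notion] -/
noncomputable def insFn (j : Fin (n + 1 + 1)) (X Y : Site 2 × Site 2) (mk : Fin (n + 1) → Site 2 × Site 2) (i : Fin (n + 1 + 1 + 1)) : Site 2 × Site 2 :=
  if h1 : i = Fin.castSucc j then X else if h2 : i = j.succ then Y else mk (unskip j i h1 h2)

omit T hn in
/-- values of the enumeration. [cite: BollobasRiordan2006, Ch. 7 §7.2.2 p. 169; lane plumbing] -/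
theorem insFn_apply (j : Fin (n + 1 + 1)) (X Y : Site 2 × Site 2) (mk : Fin (n + 1) → Site 2 × Site 2) :
    insFn n j X Y mk (Fin.castSucc j) = X ∧ insFn n j X Y mk j.succ = Y ∧ ∀ x, insFn n j X Y mk (skip j x) = mk x := by
  have hjs : j.succ ≠ Fin.castSucc j := (ne_of_lt Fin.castSucc_lt_succ).symm
  refine ⟨by unfold insFn; rw [dif_pos rfl], by unfold insFn; rw [dif_neg hjs, dif_pos rfl], fun x => ?_⟩
  unfold insFn
  rw [dif_neg (skip_ne_castSucc _ x), dif_neg (skip_ne_succ _ x), unskip_skip]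

omit T hn in
/-- the enumeration takes values in the marked set. [cite: BollobasRiordan2006, Ch. 7 §7.2.2 p. 169; lane plumbing] -/
theorem insFn_mem (j : Fin (n + 1 + 1)) (X Y : Site 2 × Site 2) {mk : Fin (n + 1) → Site 2 × Site 2} {S : Finset (Site 2 × Site 2)} (hmk : ∀ x, mk x ∈ S)
    (i : Fin (n + 1 + 1 + 1)) : insFn n j X Y mk i ∈ insert X (insert Y S) := by
  obtain ⟨eX, eY, eS⟩ := insFn_apply n j X Y mk
  rcases eq_castSucc_or_succ_or_skip j i with rfl | rfl | ⟨x, rfl⟩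
  · rw [eX]; exact Finset.mem_insert_self _ _
  · rw [eY]; exact Finset.mem_insert_of_mem (Finset.mem_insert_self _ _)
  · rw [eS]; exact Finset.mem_insert_of_mem (Finset.mem_insert_of_mem (hmk x))

omit T hn in
/-- ★ **the insertion enumeration is strictly increasing in position** as soon as `X < Y`, the old marks below `j` precede `X`, the others follow `Y`, and the old marks increase.
[cite: BollobasRiordan2006, Ch. 7 §7.2.2 p. 169 (marked sites in anticlockwise order)] -/
theorem insFn_strictMono (j : Fin (n + 1 + 1)) (X Y : Site 2 × Site 2) (mk : Fin (n + 1) → Site 2 × Site 2) (pos : Site 2 × Site 2 → ℕ) (hXY : pos X < pos Y)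
    (below : ∀ x : Fin (n + 1), x.val < j.val → pos (mk x) < pos X) (above : ∀ x : Fin (n + 1), ¬ x.val < j.val → pos Y < pos (mk x))
    (hmono : StrictMono fun x => pos (mk x)) : StrictMono fun i => pos (insFn n j X Y mk i) := by
  obtain ⟨eX, eY, eS⟩ := insFn_apply n j X Y mk
  intro a b hab
  simp only
  rcases eq_castSucc_or_succ_or_skip j a with rfl | rfl | ⟨x, rfl⟩ <;> rcases eq_castSucc_or_succ_or_skip j b with rfl | rfl | ⟨y, rfl⟩
  · exact absurd hab (lt_irrefl _)
  · rw [eX, eY]; exact hXY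
  · rw [eX, eS]
    have hy : ¬ y.val < j.val := fun h' => lt_asymm hab ((SlideDarts.skip_lt_castSucc_iff n j y).2 h')
    exact hXY.trans (above y hy)
  · exact absurd (hab.trans Fin.castSucc_lt_succ) (lt_irrefl _)
  · exact absurd hab (lt_irrefl _)
  · rw [eY, eS]
    have hy : ¬ y.val < j.val := fun h' => lt_asymm (hab.trans' Fin.castSucc_lt_succ) ((SlideDarts.skip_lt_castSucc_iff n j y).2 h')
    exact above y hy
  · rw [eS, eX]
    exact below x ((SlideDarts.skip_lt_castSucc_iff n j x).1 hab)
  · rw [eS, eY]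
    have hx : x.val < j.val := by
      have h1 : skip j x ≤ Fin.castSucc j := Fin.le_castSucc_iff.2 hab
      exact (SlideDarts.skip_lt_castSucc_iff n j x).1 (lt_of_le_of_ne h1 (skip_ne_castSucc j x))
    exact (below x hx).trans hXY
  · rw [eS, eS]
    exact hmono ((skip_lt_iff j).1 hab)

/-! ### The marks of the three new domains -/

/-- the common marks (of `D`) are common darts. [cite: BollobasRiordan2006, Ch. 7 §7.2.2 p. 169] -/
theorem mk_mem (x : Fin (n + 1)) : (T.domD n hn).markDart x ∈ S₀ := T.slideDarts₁.markDart_dom0_mem n hn x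

/-- the common marks in `E₀`-order: a mark is below the insertion index iff before `dP`, iff before `dc`, iff before `dQ`. [cite: BollobasRiordan2006, Ch. 7 §7.2.2 p. 169] -/
theorem mk_lt_iff (x : Fin (n + 1)) :
    ((D₀.rebase₀ T.bz_mem).dpos ((T.domD n hn).markDart x) < (D₀.rebase₀ T.bz_mem).dpos (slideP h₁ r₁) ↔ x.val < (T.slideDarts₁.jIns n hn).val) ∧
    ((D₀.rebase₀ T.bz_mem).dpos ((T.domD n hn).markDart x) < (D₀.rebase₀ T.bz_mem).dpos (dartC h₂ r₂) ↔ x.val < (T.slideDarts₁.jIns n hn).val) ∧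
    ((D₀.rebase₀ T.bz_mem).dpos ((T.domD n hn).markDart x) < (D₀.rebase₀ T.bz_mem).dpos (slideQ h₂ r₂ m₂) ↔ x.val < (T.slideDarts₁.jIns n hn).val) := by
  have h1 := T.slideDarts₁.dpos_markDart_lt_dP_iff n hn x
  obtain ⟨-, -, hS⟩ := T.dpos_marks
  obtain ⟨hc, hQ⟩ := hS _ (T.mk_mem n hn x)
  exact ⟨h1, hc.trans h1, hQ.trans h1⟩

/-- ★★ **THE MARKS OF `E_PQ`**: `dP` at `j⁺`, `dQ` at `j+1`, the common marks around. [cite: BollobasRiordan2006, Ch. 7 §7.2.2 p. 169; KhristoforovSmirnov2021, §1.2 (arXiv v1 p. 2)] -/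
theorem markDart_domPQ (i : Fin (n + 1 + 1 + 1)) : (T.domPQ n hn).markDart i = insFn n (T.slideDarts₁.jIns n hn) (slideP h₁ r₁) (slideQ h₂ r₂ m₂) (T.domD n hn).markDart i := by
  set E := D₀.rebase₀ T.bz_mem with hE
  obtain ⟨hPc, hcQ, -⟩ := T.dpos_marks
  refine ofDarts_markDart_eq_of_strictMono _ _ _ _ _ _ _ (fun i => insFn_mem n _ _ _ (T.mk_mem n hn) i) ?_ i
  refine insFn_strictMono n _ _ _ _ E.dpos (hPc.trans hcQ) (fun x hx => ((T.mk_lt_iff n hn x).1).2 hx) (fun x hx => ?_)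
    (T.slideDarts₁.dpos_markDart_dom0_strictMono n hn)
  have h1 : ¬ E.dpos ((T.domD n hn).markDart x) < E.dpos (slideQ h₂ r₂ m₂) := fun h' => hx (((T.mk_lt_iff n hn x).2.2).1 h')
  have h2 : E.dpos ((T.domD n hn).markDart x) ≠ E.dpos (slideQ h₂ r₂ m₂) := fun e =>
    T.dQ_not_mem ((eq_of_dpos_eq E (T.mark _ (T.mk_mem n hn x)).mem T.isMarkable_dQ.mem e) ▸ T.mk_mem n hn x)
  omega

/-- ★★ **THE MARKS OF `E_cQ`**: `dc` at `j⁺`, `dQ` at `j+1`, the common marks around. [cite: BollobasRiordan2006, Ch. 7 §7.2.2 p. 169; KhristoforovSmirnov2021, §1.2 (arXiv v1 p. 2)] -/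
theorem markDart_domCQ (i : Fin (n + 1 + 1 + 1)) : (T.domCQ n hn).markDart i = insFn n (T.slideDarts₁.jIns n hn) (dartC h₂ r₂) (slideQ h₂ r₂ m₂) (T.domD n hn).markDart i := by
  set E := D₀.rebase₀ T.bz_mem with hE
  obtain ⟨-, hcQ, -⟩ := T.dpos_marks
  refine ofDarts_markDart_eq_of_strictMono _ _ _ _ _ _ _ (fun i => insFn_mem n _ _ _ (T.mk_mem n hn) i) ?_ i
  refine insFn_strictMono n _ _ _ _ E.dpos hcQ (fun x hx => ((T.mk_lt_iff n hn x).2.1).2 hx) (fun x hx => ?_) (T.slideDarts₁.dpos_markDart_dom0_strictMono n hn)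
  have h1 : ¬ E.dpos ((T.domD n hn).markDart x) < E.dpos (slideQ h₂ r₂ m₂) := fun h' => hx (((T.mk_lt_iff n hn x).2.2).1 h')
  have h2 : E.dpos ((T.domD n hn).markDart x) ≠ E.dpos (slideQ h₂ r₂ m₂) := fun e =>
    T.dQ_not_mem ((eq_of_dpos_eq E (T.mark _ (T.mk_mem n hn x)).mem T.isMarkable_dQ.mem e) ▸ T.mk_mem n hn x)
  omega

/-- `da < db` in `G ∪ {h₁, h₂}`. [cite: BollobasRiordan2006, Ch. 7 §7.2.2 p. 168 (the boundary cycle)] -/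
theorem dpos_da_lt_db : (D₂.rebase₀ T.bz_mem₂.1).dpos (slideA h₁ r₁) < (D₂.rebase₀ T.bz_mem₂.1).dpos (slideA h₂ r₂) := by
  set E₂ := D₂.rebase₀ T.bz_mem₂.1 with hE₂
  set E₁ := D₁.rebase₀ T.bz_mem₁.1 with hE₁
  set E₀ := D₀.rebase₀ T.bz_mem with hE₀
  have hm₁ := T.m₁_le; have h1₁ := T.one_le₁; have hm₂ := T.m₂_le; have h1₂ := T.one_le₂
  -- `da < db` in `E₂` iff `da < dQ` in `E₁`
  rw [SlideDarts.da_eq_blk (h := h₂) (r := r₂), dpos_lt_blk_iff (D' := E₂) (D₁ := E₁) T.removableAt₂ T.verts_eq_erase.2 rfl T.bz_mem₂.2.1 (by rw [← dQ_eq_dPlus]; exact T.bz_ne.1)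
    T.da_mem.1 T.h₁_ne_h₂ 1 (by simp; omega), ← dQ_eq_dPlus]
  -- `dQ < da` in `E₁` iff `dQ < dc` in `E₀`, which is false
  have key : E₁.dpos (slideQ h₂ r₂ m₂) < E₁.dpos (slideA h₁ r₁) ↔ E₀.dpos (slideQ h₂ r₂ m₂) < E₀.dpos (dartC h₂ r₂) := by
    rw [SlideDarts.da_eq_blk (h := h₁) (r := r₁), T.dc_eq_dPlus]
    exact dpos_lt_blk_iff (D' := E₁) (D₁ := E₀) T.slideDarts₁.removableAt T.verts_eq_erase.1 rfl T.bz_mem₁.2 (by rw [← T.dc_eq_dPlus]; exact T.bz_ne.2)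
      T.dQ_mem.1 T.dQ_mem.2.2 1 (by simp; omega)
  have hne : E₁.dpos (slideQ h₂ r₂ m₂) ≠ E₁.dpos (slideA h₁ r₁) := fun e => by
    have := congrArg Prod.fst (eq_of_dpos_eq E₁ T.dQ_mem.1 T.da_mem.2 e)
    simp only [slideQ, slideA] at this
    exact T.notMem₁ (this ▸ T.in₂ (m₂ + 1) (by omega) (by omega))
  have hcQ := T.dpos_marks.2.1
  have : ¬ E₁.dpos (slideQ h₂ r₂ m₂) < E₁.dpos (slideA h₁ r₁) := fun h' => lt_asymm hcQ (key.1 h')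
  omega

/-- ★★ **THE MARKS OF `W`**: `da` at `j⁺`, `db` at `j+1`, the common marks around — the SAME insertion index as the three small domains.
[cite: BollobasRiordan2006, Ch. 7 §7.2.2 p. 169 (marked sites in anticlockwise order); KhristoforovSmirnov2021, §1.2 (arXiv v1 p. 2)] -/
theorem markDart_domW (i : Fin (n + 1 + 1 + 1)) : (T.domW n hn).markDart i = insFn n (T.slideDarts₁.jIns n hn) (slideA h₁ r₁) (slideA h₂ r₂) (T.domD n hn).markDart i := by
  set E₂ := D₂.rebase₀ T.bz_mem₂.1 with hE₂
  have hcm : ∀ x, (T.domD n hn).markDart x ∈ triBdryDarts D₂.verts ∧ (T.domD n hn).markDart x ∈ triBdryDarts D₁.verts ∧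
      ((T.domD n hn).markDart x).1 ≠ h₁ ∧ ((T.domD n hn).markDart x).1 ≠ h₂ := fun x => by
    obtain ⟨h2, h1, -, hh₁, hh₂⟩ := T.common_of_mem (T.mk_mem n hn x); exact ⟨h2, h1, hh₁, hh₂⟩
  refine ofDarts_markDart_eq_of_strictMono _ _ _ _ _ _ _ (fun i => insFn_mem n _ _ _ (T.mk_mem n hn) i) ?_ i
  refine insFn_strictMono n _ _ _ _ E₂.dpos T.dpos_da_lt_db (fun x hx => ?_) (fun x hx => ?_) (fun a b hab => ?_)
  · obtain ⟨h2, -, hh₁, hh₂⟩ := hcm x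
    exact (T.dpos_lt_da_iff h2 hh₁ hh₂).2 (((T.mk_lt_iff n hn x).2.1).2 hx)
  · obtain ⟨h2, -, hh₁, hh₂⟩ := hcm x
    have h1 : ¬ E₂.dpos ((T.domD n hn).markDart x) < E₂.dpos (slideA h₂ r₂) := fun h' => hx (((T.mk_lt_iff n hn x).2.2).1 ((T.dpos_lt_db_iff h2 hh₁ hh₂).1 h'))
    have hne : E₂.dpos ((T.domD n hn).markDart x) ≠ E₂.dpos (slideA h₂ r₂) := fun e => hh₂ (by rw [eq_of_dpos_eq E₂ h2 T.db_mem e]; rfl)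
    omega
  · obtain ⟨ha2, ha1, ha₁, ha₂⟩ := hcm a
    obtain ⟨hb2, hb1, hb₁, hb₂⟩ := hcm b
    simp only
    rw [T.dpos_lt_iff₂₁ ha2 ha₂ hb2 hb₂, T.dpos_lt_iff₁₀ ha1 ha₁ hb1 hb₁]
    exact T.slideDarts₁.dpos_markDart_dom0_strictMono n hn hab

/-! ## §6 The corner faces -/

/-- ★ **the common corner faces of `E_PQ` are those of `D`, relabelled by `skip`.** [cite: KhristoforovSmirnov2021, §1.2 (arXiv v1 p. 2: the corner disorders)] -/
theorem yc_domPQ_skip (x : Fin (n + 1)) : yc (T.domPQ n hn) (skip (T.slideDarts₁.jIns n hn) x) = yc (T.domD n hn) x := by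
  have hmark : (T.domPQ n hn).markDart (skip (T.slideDarts₁.jIns n hn) x) = (T.domD n hn).markDart x := by
    rw [T.markDart_domPQ n hn, (insFn_apply n _ _ _ _).2.2 x]
  have hpred : predDart (T.domPQ n hn) (skip (T.slideDarts₁.jIns n hn) x) = predDart (T.domD n hn) x :=
    (T.domPQ n hn).predDart_eq_of_succ_eq _ (predDart_mem (T.domD n hn) x) (by rw [hmark]; exact succ_predDart (T.domD n hn) x)
  apply eq_yc
  unfold IsCornerFace
  rw [yc_spec (T.domPQ n hn) _, TriMarkedDomain.markSite, TriMarkedDomain.markSite, hmark, hpred]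

/-- ★ **the common corner faces of `E_cQ` are those of `D`, relabelled by `skip`.** [cite: KhristoforovSmirnov2021, §1.2 (arXiv v1 p. 2: the corner disorders)] -/
theorem yc_domCQ_skip (x : Fin (n + 1)) : yc (T.domCQ n hn) (skip (T.slideDarts₁.jIns n hn) x) = yc (T.domD n hn) x := by
  have hmark : (T.domCQ n hn).markDart (skip (T.slideDarts₁.jIns n hn) x) = (T.domD n hn).markDart x := by
    rw [T.markDart_domCQ n hn, (insFn_apply n _ _ _ _).2.2 x]
  have hpred : predDart (T.domCQ n hn) (skip (T.slideDarts₁.jIns n hn) x) = predDart (T.domD n hn) x :=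
    (T.domCQ n hn).predDart_eq_of_succ_eq _ (predDart_mem (T.domD n hn) x) (by rw [hmark]; exact succ_predDart (T.domD n hn) x)
  apply eq_yc
  unfold IsCornerFace
  rw [yc_spec (T.domCQ n hn) _, TriMarkedDomain.markSite, TriMarkedDomain.markSite, hmark, hpred]

/-- **the predecessor dart of a common mark is a dart of `∂(G ∪ {h₁, h₂})`** (its head is neither `h₁` — it is a dart of `∂(G ∪ {h₁})` by «CONTRACT-OF-DARTS» — nor `h₂`: a dart
into `h₂` is followed by a dart into `h₂` or by `dQ`, never by a common mark). [cite: BollobasRiordan2006, Ch. 7 §7.2.2 p. 169 (marked at the second outside neighbour)] -/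
theorem predDart_mem₂ (x : Fin (n + 1)) : predDart (T.domD n hn) x ∈ triBdryDarts D₂.verts ∧ triBdrySucc D₂.verts (predDart (T.domD n hn) x) = (T.domD n hn).markDart x := by
  have T₁ := T.slideDarts₁
  have hm := T.m₂_le
  set e₀ := predDart (T.domD n hn) x with he₀
  have hS : (T.domD n hn).markDart x ∈ S₀ := T.mk_mem n hn x
  obtain ⟨-, -, -, -, hmk₂⟩ := T.common_of_mem hS
  have hmk2 : ((T.domD n hn).markDart x).2 ≠ h₂ := (T.sub _ hS).2.2
  -- `e₀` is the predecessor in `G ∪ {h₁}` too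
  have he₁ : predDart (T.slideDarts₁.dom0' n hn) x = e₀ := T.slideDarts₁.predDart_dom0'_eq n hn x
  have hmem₁ : e₀ ∈ triBdryDarts D₁.verts := by rw [← he₁]; exact predDart_mem (T.slideDarts₁.dom0' n hn) x
  have hsucc₁ : triBdrySucc D₁.verts e₀ = (T.domD n hn).markDart x := by
    rw [← he₁]
    have h1 := succ_predDart (T.slideDarts₁.dom0' n hn) x
    rw [T.slideDarts₁.markDart_dom0'_eq n hn x] at h1
    exact h1
  obtain ⟨hx, hy, hadj⟩ := mem_triBdryDarts.1 hmem₁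
  have hxG : e₀.1 ∈ D₀.verts := (mem_triBdryDarts.1 (predDart_mem (T.domD n hn) x)).1
  -- its head is not `h₂`
  have hy₂ : e₀.2 ≠ h₂ := by
    intro e
    obtain ⟨l, hl⟩ := (triGraph_adj_iff_triDir e₀.2 e₀.1).1 hadj.symm
    rw [e] at hl
    obtain ⟨t, rfl⟩ : ∃ t : Fin 6, l = r₂ + t := ⟨l - r₂, by rw [add_sub_cancel]⟩
    have hnw : e₀ = RemovableAt.nw h₂ r₂ t := Prod.ext hl e
    have ht : m₂ < t := by
      by_contra hle
      exact T.out₂ t (not_lt.1 hle) (hl ▸ hxG)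
    have ht5 : t ≠ 5 := fun h5 => T.notMem₁ (by rw [hl, h5, T.h₁_eq] at hxG; exact hxG)
    rw [hnw, T.verts_eq_erase.2] at hsucc₁
    rcases (show m₂ + 1 < t ∨ t = m₂ + 1 by omega) with hlt | rfl
    · rw [T.removableAt₂.succ_erase_nw (by omega)] at hsucc₁
      exact hmk2 (by rw [← hsucc₁]; rfl)
    · rw [T.removableAt₂.succ_erase_nw_last, ← dQ_eq_dPlus] at hsucc₁
      exact T.dQ_not_mem (hsucc₁ ▸ hS)
  have hmem₂ : e₀ ∈ triBdryDarts D₂.verts := by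
    refine mem_triBdryDarts.2 ⟨T.verts_subset.2 hx, ?_, hadj⟩
    rw [T.verts₂, Finset.mem_insert, not_or]; exact ⟨hy₂, hy⟩
  -- it is not `dMinus` of `h₂` (whose tail is `h₁ ∉ G`)
  have hdm : e₀ ≠ RemovableAt.dMinus h₂ r₂ := by
    intro e
    have := congrArg Prod.fst e
    simp only [RemovableAt.dMinus] at this
    rw [T.h₁_eq] at this
    exact T.notMem₁ (this ▸ hxG)
  refine ⟨hmem₂, ?_⟩
  rw [← T.removableAt₂.succ_erase_eq hmem₂ hdm, ← T.verts_eq_erase.2, hsucc₁]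

/-- ★★ **the common corner faces of `W` are those of `D`, relabelled by `skip`** (the predecessor dart of a common mark avoids both notches). [cite: KhristoforovSmirnov2021, §1.2 (arXiv v1 p. 2: the corner disorders); BollobasRiordan2006, Ch. 7 §7.2.2 p. 169] -/
theorem yc_domW_skip (x : Fin (n + 1)) : yc (T.domW n hn) (skip (T.slideDarts₁.jIns n hn) x) = yc (T.domD n hn) x := by
  have hmark : (T.domW n hn).markDart (skip (T.slideDarts₁.jIns n hn) x) = (T.domD n hn).markDart x := by
    rw [T.markDart_domW n hn, (insFn_apply n _ _ _ _).2.2 x]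
  obtain ⟨hmem₂, hsucc₂⟩ := T.predDart_mem₂ n hn x
  have hpred : predDart (T.domW n hn) (skip (T.slideDarts₁.jIns n hn) x) = predDart (T.domD n hn) x :=
    (T.domW n hn).predDart_eq_of_succ_eq _ hmem₂ (by rw [hmark]; exact hsucc₂)
  apply eq_yc
  unfold IsCornerFace
  rw [yc_spec (T.domW n hn) _, TriMarkedDomain.markSite, TriMarkedDomain.markSite, hmark, hpred]

/-- ★ **the new corner faces of `W`: `a = N¹_0` at `j⁺`, `b = N²_0` at `j+1`.** [cite: KhristoforovSmirnov2021, §1.2 (arXiv v1 p. 2: the corner disorders); BollobasRiordan2006, Ch. 7 §7.2.2 p. 169] -/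
theorem yc_domW_ends : yc (T.domW n hn) (Fin.castSucc (T.slideDarts₁.jIns n hn)) = leftFaceDir h₁ r₁ ∧ yc (T.domW n hn) (T.slideDarts₁.jIns n hn).succ = leftFaceDir h₂ r₂ := by
  obtain ⟨eA, eB, -⟩ := insFn_apply n (T.slideDarts₁.jIns n hn) (slideA h₁ r₁) (slideA h₂ r₂) (T.domD n hn).markDart
  have hm₁ := T.m₁_le
  constructor
  · refine yc_eq_leftFaceDir (T.domW n hn) _ (by rw [T.markDart_domW n hn, eA]; rfl) ?_
    show h₁ + triDir r₁ ∉ D₂.verts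
    rw [T.verts₂, Finset.mem_insert, not_or, T.verts₁, Finset.mem_insert, not_or]
    refine ⟨fun e => ?_, fun e => add_triDir_ne h₁ _ e, by have := T.out₁ 0 (Fin.zero_le _); rwa [add_zero] at this⟩
    rw [T.h₂_eq] at e
    have h6 : r₁ + 0 = r₁ + (m₁ + 1) := by rw [add_zero]; exact triDir_injective (add_left_cancel e)
    have h7 : (0 : Fin 6) = m₁ + 1 := add_left_cancel h6
    omega
  · refine yc_eq_leftFaceDir (T.domW n hn) _ (by rw [T.markDart_domW n hn, eB]; rfl) ?_
    have hm₂ := T.m₂_le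
    have := T.removableAt₂.out (t := 0) (by simp only [Fin.val_zero]; omega)
    rwa [add_zero] at this

/-- ★ **the new corner faces of `E_PQ`: `P = N¹_5` at `j⁺`, `Q = N²_{m₂}` at `j+1`.** [cite: KhristoforovSmirnov2021, §1.2 (arXiv v1 p. 2: the corner disorders); BollobasRiordan2006, Ch. 7 §7.2.2 p. 169] -/
theorem yc_domPQ_ends : yc (T.domPQ n hn) (Fin.castSucc (T.slideDarts₁.jIns n hn)) = leftFaceDir h₁ (r₁ + 5) ∧
    yc (T.domPQ n hn) (T.slideDarts₁.jIns n hn).succ = leftFaceDir h₂ (r₂ + m₂) := by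
  obtain ⟨eP, eQ, -⟩ := insFn_apply n (T.slideDarts₁.jIns n hn) (slideP h₁ r₁) (slideQ h₂ r₂ m₂) (T.domD n hn).markDart
  have hm₂ := T.m₂_le
  constructor
  · -- `dP = (g, g + e_{(r₁+1)+1})`, `g = h₁ + e_{r₁+5}`, `g + e_{r₁+1} = h₁ + e_{r₁}`
    have e2 : h₁ + triDir (r₁ + 5) + triDir (r₁ + 1 + 1) = h₁ := by
      rw [show r₁ + 1 + 1 = r₁ + 5 + 3 by omega, add_triDir_add_triDir_add_three']
    have e1 : h₁ + triDir (r₁ + 5) + triDir (r₁ + 1) = h₁ + triDir r₁ := by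
      rw [show r₁ + 1 = r₁ + 5 + 2 by omega, add_triDir_add_triDir_add_two', show r₁ + 5 + 1 = r₁ by omega]
    have h0 : h₁ + triDir r₁ ∉ D₀.verts := by have := T.out₁ 0 (Fin.zero_le _); rwa [add_zero] at this
    have hmark : (T.domPQ n hn).markDart (Fin.castSucc (T.slideDarts₁.jIns n hn)) = (h₁ + triDir (r₁ + 5), h₁ + triDir (r₁ + 5) + triDir (r₁ + 1 + 1)) := by
      rw [T.markDart_domPQ n hn, eP, e2]; rfl
    rw [yc_eq_leftFaceDir (T.domPQ n hn) _ hmark (by rw [e1]; exact h0), show r₁ + 1 = r₁ + 5 + 2 by omega]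
    exact leftFaceDir_add_triDir h₁ (r₁ + 5)
  · -- `dQ = (g, g + e_{J+1})`, `J = r₂ + m₂ + 4`, `g + e_J = h₂`
    have eJ : h₂ + triDir (r₂ + (m₂ + 1)) + triDir (r₂ + (m₂ + 4)) = h₂ := by
      rw [show r₂ + (m₂ + 4) = r₂ + (m₂ + 1) + 3 by omega, add_triDir_add_triDir_add_three']
    have eJ1 : h₂ + triDir (r₂ + (m₂ + 1)) + triDir (r₂ + (m₂ + 4) + 1) = h₂ + triDir (r₂ + m₂) := by
      rw [show r₂ + (m₂ + 4) + 1 = r₂ + (m₂ + 1) + 4 by omega, add_triDir_add_triDir_add_four, show r₂ + (m₂ + 1) + 5 = r₂ + m₂ by omega]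
    have hmark : (T.domPQ n hn).markDart (T.slideDarts₁.jIns n hn).succ = (h₂ + triDir (r₂ + (m₂ + 1)), h₂ + triDir (r₂ + (m₂ + 1)) + triDir (r₂ + (m₂ + 4) + 1)) := by
      rw [T.markDart_domPQ n hn, eQ, eJ1]; rfl
    rw [yc_eq_leftFaceDir (T.domPQ n hn) _ hmark (by rw [eJ]; exact T.notMem₂), show r₂ + (m₂ + 4) = r₂ + m₂ + 4 by omega,
      show r₂ + (m₂ + 1) = r₂ + m₂ + 1 by omega]
    exact SlideDarts.leftFaceDir_contactQ h₂ (r₂ + m₂)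

/-- ★ **the new corner faces of `E_cQ`: `c = N²_4 = N¹_{m₁+1}` at `j⁺`, `Q = N²_{m₂}` at `j+1`.** [cite: KhristoforovSmirnov2021, §1.2 (arXiv v1 p. 2: the corner disorders); BollobasRiordan2006, Ch. 7 §7.2.2 p. 169] -/
theorem yc_domCQ_ends : yc (T.domCQ n hn) (Fin.castSucc (T.slideDarts₁.jIns n hn)) = leftFaceDir h₁ (r₁ + (m₁ + 1)) ∧
    yc (T.domCQ n hn) (T.slideDarts₁.jIns n hn).succ = leftFaceDir h₂ (r₂ + m₂) := by
  obtain ⟨eC, eQ, -⟩ := insFn_apply n (T.slideDarts₁.jIns n hn) (dartC h₂ r₂) (slideQ h₂ r₂ m₂) (T.domD n hn).markDart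
  have hm₂ := T.m₂_le
  have hr := T.r₂_eq
  constructor
  · -- `dc = (s, s + e_{r₂+1})`, `s = h₂ + e_{r₂+4}`, `s + e_{r₂} = h₁`
    have e2 : h₂ + triDir (r₂ + 4) + triDir (r₂ + 1) = h₂ := by
      rw [show r₂ + 1 = r₂ + 4 + 3 by omega, add_triDir_add_triDir_add_three']
    have e1 : h₂ + triDir (r₂ + 4) + triDir r₂ = h₁ := by
      rw [add_right_comm, add_triDir_add_triDir_add_four, T.h₁_eq]
    have hmark : (T.domCQ n hn).markDart (Fin.castSucc (T.slideDarts₁.jIns n hn)) = (h₂ + triDir (r₂ + 4), h₂ + triDir (r₂ + 4) + triDir (r₂ + 1)) := by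
      rw [T.markDart_domCQ n hn, eC, e2]; rfl
    rw [yc_eq_leftFaceDir (T.domCQ n hn) _ hmark (by rw [e1]; exact T.notMem₁)]
    have e3 := leftFaceDir_add_triDir h₂ (r₂ + 4)
    rw [show r₂ + 4 + 2 = r₂ by omega] at e3
    rw [e3, T.h₂_eq, hr, show r₁ + (m₁ + 5) + 4 = r₁ + (m₁ + 1) + 2 by omega]
    exact leftFaceDir_add_triDir h₁ (r₁ + (m₁ + 1))
  · have eJ : h₂ + triDir (r₂ + (m₂ + 1)) + triDir (r₂ + (m₂ + 4)) = h₂ := by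
      rw [show r₂ + (m₂ + 4) = r₂ + (m₂ + 1) + 3 by omega, add_triDir_add_triDir_add_three']
    have eJ1 : h₂ + triDir (r₂ + (m₂ + 1)) + triDir (r₂ + (m₂ + 4) + 1) = h₂ + triDir (r₂ + m₂) := by
      rw [show r₂ + (m₂ + 4) + 1 = r₂ + (m₂ + 1) + 4 by omega, add_triDir_add_triDir_add_four, show r₂ + (m₂ + 1) + 5 = r₂ + m₂ by omega]
    have hmark : (T.domCQ n hn).markDart (T.slideDarts₁.jIns n hn).succ = (h₂ + triDir (r₂ + (m₂ + 1)), h₂ + triDir (r₂ + (m₂ + 1)) + triDir (r₂ + (m₂ + 4) + 1)) := by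
      rw [T.markDart_domCQ n hn, eQ, eJ1]; rfl
    rw [yc_eq_leftFaceDir (T.domCQ n hn) _ hmark (by rw [eJ]; exact T.notMem₂), show r₂ + (m₂ + 4) = r₂ + m₂ + 4 by omega,
      show r₂ + (m₂ + 1) = r₂ + m₂ + 1 by omega]
    exact SlideDarts.leftFaceDir_contactQ h₂ (r₂ + m₂)

/-! ## §7 The observed mid-edge on the home stretch of the five domains -/

omit T hn in
/-- the first mark of `ofDarts` has positive position when the base is not a mark. [cite: BollobasRiordan2006, Ch. 7 §7.2.2 p. 169; lane plumbing] -/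
theorem dartPos_zero_ne_zero (E : TriMarkedDomain 0) {k : ℕ} (hk : 0 < k) (S : Finset (Site 2 × Site 2)) (hc : #S = k) (hS : ∀ d ∈ S, IsMarkable E.verts d)
    (hi : Set.InjOn Prod.fst (S : Set (Site 2 × Site 2))) (hb : E.base ∉ S) : E.dartPos S (E.card_visitTimes_of_markable _ hc hS) ⟨0, hk⟩ ≠ 0 := by
  rw [← E.dpos_ofDarts_markDart hk S hc hS hi]
  intro h0
  have hm := E.ofDarts_markDart_mem hk S hc hS hi ⟨0, hk⟩
  have := E.iter_dpos (hS _ hm).mem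
  rw [h0, triBdryIter_zero] at this
  exact hb (this ▸ hm)

/-- ★ **the observed dart lies on the HOME stretch of `W`, `E_PQ`, `E_cQ`** (it is their base of numbering, before the first mark). [cite: KhristoforovSmirnov2021, §2 eq. (4) and Remark 6 (arXiv v1 p. 5); BollobasRiordan2006, Ch. 7 §7.2.2 p. 169] -/
theorem bz_mem_stretch : bz ∈ (T.domW n hn).stretch (Fin.last (n + 1 + 1)) ∧ bz ∈ (T.domPQ n hn).stretch (Fin.last (n + 1 + 1)) ∧
    bz ∈ (T.domCQ n hn).stretch (Fin.last (n + 1 + 1)) := by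
  have hl : ¬ (Fin.last (n + 1 + 1)).val + 1 < n + 1 + 1 + 1 := by simp
  have hbW : bz ∉ insert (slideA h₁ r₁) (insert (slideA h₂ r₂) S₀) := by
    rw [Finset.mem_insert, Finset.mem_insert, not_or, not_or]
    exact ⟨fun e => T.bz_mem₂.2.2 (by rw [e]; rfl), fun e => T.bz_mem₂.2.1 (by rw [e]; rfl), T.bz_not_mem⟩
  have hbPQ : bz ∉ insert (slideP h₁ r₁) (insert (slideQ h₂ r₂ m₂) S₀) := by
    rw [Finset.mem_insert, Finset.mem_insert, not_or, not_or]
    exact ⟨fun e => T.bz_snd.1 (by rw [e]; rfl), T.bz_ne.1, T.bz_not_mem⟩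
  have hbCQ : bz ∉ insert (dartC h₂ r₂) (insert (slideQ h₂ r₂ m₂) S₀) := by
    rw [Finset.mem_insert, Finset.mem_insert, not_or, not_or]
    exact ⟨T.bz_ne.2, T.bz_ne.1, T.bz_not_mem⟩
  have h0 : (D₀.rebase₀ T.bz_mem).dpos bz = 0 := (D₀.rebase₀ T.bz_mem).dpos_eq_of_iter_eq (D₀.rebase₀ T.bz_mem).isTriDisc.card_pos rfl
  have h2 : (D₂.rebase₀ T.bz_mem₂.1).dpos bz = 0 := (D₂.rebase₀ T.bz_mem₂.1).dpos_eq_of_iter_eq (D₂.rebase₀ T.bz_mem₂.1).isTriDisc.card_pos rfl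
  refine ⟨?_, ?_, ?_⟩
  · unfold domW
    rw [mem_stretch_ofDarts_last_iff _ _ _ _ _ _ _ hl]
    exact ⟨T.bz_mem₂.1, Or.inr (by rw [h2]; exact Nat.pos_of_ne_zero (dartPos_zero_ne_zero (D₂.rebase₀ T.bz_mem₂.1) (by omega) _ (by rw [T.setW.2.2, hn]) T.setW.2.1 T.setW.1 hbW))⟩
  · unfold domPQ
    rw [mem_stretch_ofDarts_last_iff _ _ _ _ _ _ _ hl]
    exact ⟨T.bz_mem, Or.inr (by rw [h0]; exact Nat.pos_of_ne_zero (dartPos_zero_ne_zero (D₀.rebase₀ T.bz_mem) (by omega) _ (by rw [T.setPQ.2.2, hn]) T.setPQ.2.1 T.setPQ.1 hbPQ))⟩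
  · unfold domCQ
    rw [mem_stretch_ofDarts_last_iff _ _ _ _ _ _ _ hl]
    exact ⟨T.bz_mem, Or.inr (by rw [h0]; exact Nat.pos_of_ne_zero (dartPos_zero_ne_zero (D₀.rebase₀ T.bz_mem) (by omega) _ (by rw [T.setCQ.2.2, hn]) T.setCQ.2.1 T.setCQ.1 hbCQ))⟩

/-- **the observed mid-edge in `W`.** [cite: KhristoforovSmirnov2021, §2 eq. (4) and Remark 6 (arXiv v1 p. 5)] -/
noncomputable def arcPointW : ArcPoint (T.domW n hn) (Fin.last (n + 1 + 1)) :=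
  ArcPoint.ofFlatDart (g := bz.1) (o := bz.2) (T.bz_mem_stretch n hn).1 (T.verts_subset.2 (T.verts_subset.1 T.flat.1)) (T.verts_subset.2 (T.verts_subset.1 T.flat.2))

/-- **the observed mid-edge in `E_PQ`.** [cite: KhristoforovSmirnov2021, §2 eq. (4) and Remark 6 (arXiv v1 p. 5)] -/
noncomputable def arcPointPQ : ArcPoint (T.domPQ n hn) (Fin.last (n + 1 + 1)) :=
  ArcPoint.ofFlatDart (g := bz.1) (o := bz.2) (T.bz_mem_stretch n hn).2.1 T.flat.1 T.flat.2

/-- **the observed mid-edge in `E_cQ`.** [cite: KhristoforovSmirnov2021, §2 eq. (4) and Remark 6 (arXiv v1 p. 5)] -/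
noncomputable def arcPointCQ : ArcPoint (T.domCQ n hn) (Fin.last (n + 1 + 1)) :=
  ArcPoint.ofFlatDart (g := bz.1) (o := bz.2) (T.bz_mem_stretch n hn).2.2 T.flat.1 T.flat.2

/-- the five mid-edges are read at the same face and side. [cite: KhristoforovSmirnov2021, §2 eq. (4) (arXiv v1 p. 5); lane plumbing] -/
theorem arcPoint_v_i : ((T.arcPointW n hn).v = (T.slideDarts₁.arcPoint0 n hn).v ∧ (T.arcPointW n hn).i = (T.slideDarts₁.arcPoint0 n hn).i) ∧
    ((T.arcPointPQ n hn).v = (T.slideDarts₁.arcPoint0 n hn).v ∧ (T.arcPointPQ n hn).i = (T.slideDarts₁.arcPoint0 n hn).i) ∧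
    ((T.arcPointCQ n hn).v = (T.slideDarts₁.arcPoint0 n hn).v ∧ (T.arcPointCQ n hn).i = (T.slideDarts₁.arcPoint0 n hn).i) := by
  have hs0 : side (T.slideDarts₁.arcPoint0 n hn).v (T.slideDarts₁.arcPoint0 n hn).i = s(bz.1, bz.2) := by
    unfold SlideDarts.arcPoint0; exact ArcPoint.side_ofFlatDart _ _ _
  have hv0 : (T.slideDarts₁.arcPoint0 n hn).v = leftFace bz.1 bz.2 := by unfold SlideDarts.arcPoint0; rw [ArcPoint.ofFlatDart_v]
  have key : ∀ {k : ℕ} {E : TriMarkedDomain k} {a : Fin k} (z : ArcPoint E a), z.v = leftFace bz.1 bz.2 → side z.v z.i = s(bz.1, bz.2) →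
      z.v = (T.slideDarts₁.arcPoint0 n hn).v ∧ z.i = (T.slideDarts₁.arcPoint0 n hn).i := by
    intro k E a z hv hs
    have hv' : z.v = (T.slideDarts₁.arcPoint0 n hn).v := by rw [hv, hv0]
    refine ⟨hv', ?_⟩
    apply side_injective (T.slideDarts₁.arcPoint0 n hn).v
    rw [← hv', hs, hv', hs0]
  refine ⟨key _ (by unfold arcPointW; rw [ArcPoint.ofFlatDart_v]) (by unfold arcPointW; exact ArcPoint.side_ofFlatDart _ _ _),
    key _ (by unfold arcPointPQ; rw [ArcPoint.ofFlatDart_v]) (by unfold arcPointPQ; exact ArcPoint.side_ofFlatDart _ _ _),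
    key _ (by unfold arcPointCQ; rw [ArcPoint.ofFlatDart_v]) (by unfold arcPointCQ; exact ArcPoint.side_ofFlatDart _ _ _)⟩

/-! ## §8 The two-cell data of the constructed domains, and the identity -/

/-- ★★ **`W` IS `D` WITH THE TWO CELLS ATTACHED AND THE NEW CORNERS `a`, `b` AT THE INSERTION INDEX.** [cite: KhristoforovSmirnov2021, §1.2 (arXiv v1 pp. 2–3); BollobasRiordan2006, Ch. 7 §7.2.2 pp. 168–169] -/
theorem twoCellData : TwoCellData (T.domW n hn) (T.domD n hn) h₁ h₂ r₁ m₁ 0 r₂ m₂ 0 (Fin.castSucc (T.slideDarts₁.jIns n hn)) (T.slideDarts₁.jIns n hn).succ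
    (T.slideDarts₁.jIns n hn) where
  verts' := by
    show D₂.verts = insert h₁ (insert h₂ D₀.verts)
    rw [T.verts₂, T.verts₁, Finset.insert_comm]
  notMem₁ := T.notMem₁
  notMem₂ := T.notMem₂
  h₂_eq := T.h₂_eq
  r₂_eq := T.r₂_eq
  out₁ := T.out₁
  in₁ := T.in₁
  out₂ := T.out₂
  in₂ := T.in₂
  m₁_le := by have := T.m₁_le; omega
  m₂_le := by have := T.m₂_le; omega
  k₁_lt := by have := T.one_le₁; have := T.m₁_le; rw [Fin.lt_def]; simp only [Fin.val_zero]; omega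
  k₂_lt := by have := T.one_le₂; have := T.m₂_le; rw [Fin.lt_def]; simp only [Fin.val_zero]; omega
  yc_skip := T.yc_domW_skip n hn
  pair := Or.inl ⟨rfl, rfl⟩
  yc_a := by rw [add_zero]; exact (T.yc_domW_ends n hn).1
  yc_b := by rw [add_zero]; exact (T.yc_domW_ends n hn).2

/-- ★ **`E_PQ` is `D` marked additionally at `P`, `Q`.** [cite: KhristoforovSmirnov2021, §1.2 (arXiv v1 pp. 2–3); BollobasRiordan2006, Ch. 7 §7.2.2 p. 169] -/
theorem marksPQ : TwoCellMarks (T.domD n hn) (T.domPQ n hn) (Fin.castSucc (T.slideDarts₁.jIns n hn)) (T.slideDarts₁.jIns n hn).succ (T.slideDarts₁.jIns n hn)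
    (leftFaceDir h₁ (r₁ + 5)) (leftFaceDir h₂ (r₂ + m₂)) where
  verts := rfl
  yc_skip := T.yc_domPQ_skip n hn
  yc_a := (T.yc_domPQ_ends n hn).1
  yc_b := (T.yc_domPQ_ends n hn).2

/-- ★ **`E_Pc` is `D` marked additionally at `P`, `c`** (the first attachment's doubly-marked domain). [cite: KhristoforovSmirnov2021, §1.2 (arXiv v1 pp. 2–3); BollobasRiordan2006, Ch. 7 §7.2.2 p. 169] -/
theorem marksPc : TwoCellMarks (T.domD n hn) (T.domPc n hn) (Fin.castSucc (T.slideDarts₁.jIns n hn)) (T.slideDarts₁.jIns n hn).succ (T.slideDarts₁.jIns n hn)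
    (leftFaceDir h₁ (r₁ + 5)) (leftFaceDir h₁ (r₁ + (m₁ + 1))) where
  verts := rfl
  yc_skip := (T.slideDarts₁.marksData n hn).yc_skip
  yc_a := (T.slideDarts₁.yc_domPQ_ends n hn).1
  yc_b := (T.slideDarts₁.yc_domPQ_ends n hn).2

/-- ★ **`E_cQ` is `D` marked additionally at `c`, `Q`.** [cite: KhristoforovSmirnov2021, §1.2 (arXiv v1 pp. 2–3); BollobasRiordan2006, Ch. 7 §7.2.2 p. 169] -/
theorem marksCQ : TwoCellMarks (T.domD n hn) (T.domCQ n hn) (Fin.castSucc (T.slideDarts₁.jIns n hn)) (T.slideDarts₁.jIns n hn).succ (T.slideDarts₁.jIns n hn)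
    (leftFaceDir h₁ (r₁ + (m₁ + 1))) (leftFaceDir h₂ (r₂ + m₂)) where
  verts := rfl
  yc_skip := T.yc_domCQ_skip n hn
  yc_a := (T.yc_domCQ_ends n hn).1
  yc_b := (T.yc_domCQ_ends n hn).2

/-- ★★★★ **THE TWO-CELL CAP IDENTITY, CONSTRUCTED**: for ANY unmarked discrete domains `Ω ⊂ Ω ∪ h₁ ⊂ Ω ∪ h₁ ∪ h₂` with two adjacent cells attached along the boundary as in
`TwoCellDarts` (outer runs of 2–3 cells each, first contact end simple), any nonempty set `S₀` of common marks (markable in the three domains, tails off the three contact cells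
carrying `P`, `c`, `Q`, not containing the `Q`- and `c`-darts) and any flat common observed dart off the marks,
  `lawLP z(Ω ∪ h₁ ∪ h₂; M + a + b) = capInsL j (lawLP z(Ω; M)) + lawLP z(Ω; M + p + q) + lawLP z(Ω; M + p + c) + lawLP z(Ω; M + c + q)`
in the planar Temperley–Lieb module — the BR-representable replacement of the one-hexagon cap surgery F1, realised on lawpoints of the lane's marked-domain family.
[cite: KhristoforovSmirnov2021, §1.2 (arXiv v1 p. 2: the law of the link pattern), §2 Definition 3 and Remark 6 (pp. 4–5); PearceRittenbergDeGierNienhuis2002, §2 (monoid: the cup–cap); BollobasRiordan2006, Ch. 7 §7.2.2 pp. 168–169] -/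
theorem lawLP_eq_twoCellCap :
    lawLP (T.arcPointW n hn) = capInsL ℂ (Fin.castSucc (T.slideDarts₁.jIns n hn)) (lawLP (T.slideDarts₁.arcPoint0 n hn)) + lawLP (T.arcPointPQ n hn) +
      lawLP (T.slideDarts₁.arcPointPQ n hn) + lawLP (T.arcPointCQ n hn) := by
  obtain ⟨⟨hvW, hiW⟩, ⟨hvPQ, hiPQ⟩, ⟨hvCQ, hiCQ⟩⟩ := T.arcPoint_v_i n hn
  obtain ⟨-, -, hvPc, hiPc⟩ := T.slideDarts₁.arcPoint_v_i₀ n hn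
  exact (T.twoCellData n hn).lawLP_eq_twoCellCap (T.marksPQ n hn) (T.marksPc n hn) (T.marksCQ n hn) (T.arcPointW n hn) (T.slideDarts₁.arcPoint0 n hn) (T.arcPointPQ n hn)
    (T.slideDarts₁.arcPointPQ n hn) (T.arcPointCQ n hn) hvW hiW hvPQ hiPQ hvPc hiPc hvCQ hiCQ

end TwoCellDarts

end TwoCellOfDarts

end Literature.Probability.Percolation.MarkedLoops
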